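import Summits.ValiantsHypothesis.ValiantsHypothesis.Theorems.NewtonUnitEquationsTwoProductsPermutationTypeFamily
import Summits.ValiantsHypothesis.ValiantsHypothesis.Theorems.NewtonUnitEquationsTwoProductsFormalLogLinearisationLiftedPencilCountBound
import Summits.ValiantsHypothesis.ValiantsHypothesis.Theorems.NewtonUnitEquationsTwoProductsFormalLogLinearisationShiftRankCell
import Summits.ValiantsHypothesis.ValiantsHypothesis.Theorems.NewtonUnitEquationsTwoProductsFormalLogLinearisationBinomialPencilCount

/-!
# Route NewtonUnitEquations — crux `TwoProducts` (stmt-ValiantsHypothesis-5906), line `relation_ladder`, rung R6b (three-term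
# rank one, shape `α = β + γ`): the FREE LIFT — `RankOneThreeLaw`, UNCONDITIONAL

val-idea-8 g3 (ideator; lens decomp), 2026-08-28. Companion of `Lines/relation_ladder_R6.lean` (R6, shape `α + β = γ + δ`, Segre
lift). New ingredient: the relation is INHOMOGENEOUS, so the fibres of the lift `Y_α ↦ Y_β Y_γ` have VARYING letter count and the
slice sums are no longer binomial-exponential sums of bounded width; they carry the extra factor `C(λ(ν) + b - 1 - k, b - k)` with
`λ` an ADDITIVE form, which still has finite SHIFT RANK — so val-lit-p3's general strict-pencil-minimiser count for finite shift
rank (`…FormalLogLinearisation.ShiftRank.pencilCount`, LANDED) applies BY NAME. Everything here is sorry-free; nothing moves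
VP ≠ VNP; `TwoProducts` (5906) stays OPEN. [folklore]
-/

noncomputable section

set_option linter.dupNamespace false
set_option linter.unusedSimpArgs false
set_option linter.deprecated false
set_option linter.unusedSectionVars false

namespace Summit.ValiantsHypothesis.ValiantsHypothesis.Theorems.NewtonUnitEquations.TwoProducts.PermutationType
namespace R6b
open scoped BigOperators
open MvPolynomial

variable {σ : Type*} [Fintype σ] [DecidableEq σ]

/-! ## Part T1: monomial substitutions `Y_i ↦ Y^{M i}` (verbatim copy of the R6 module's Toric section) -/

section Toric
variable {τ : Type*} [Fintype τ] [DecidableEq τ] (M : σ → (τ →₀ ℕ))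

/-- The monomial substitution `Y_i ↦ Y^{M i}`. [folklore] -/
def phiT : MvPolynomial σ ℂ →ₐ[ℂ] MvPolynomial τ ℂ :=
  aeval fun i => (monomial (M i) (1 : ℂ) : MvPolynomial τ ℂ)

/-- The induced map on exponents. [folklore] -/
def piT (κ : σ →₀ ℕ) : τ →₀ ℕ := κ.sum fun i k => k • M i

omit [Fintype τ] [DecidableEq τ] [DecidableEq σ] in
/-- `piT` as a sum over the index type. [folklore] -/
theorem piT_eq_sum (κ : σ →₀ ℕ) : piT M κ = ∑ i, κ i • M i := by
  unfold piT; exact Finsupp.sum_fintype _ _ (fun _ => by simp)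

omit [Fintype σ] [DecidableEq σ] [Fintype τ] [DecidableEq τ] in
/-- `piT` is the `ℕ`-linear extension of `M`. [folklore] -/
theorem piT_eq_linearCombination (κ : σ →₀ ℕ) : piT M κ = Finsupp.linearCombination ℕ M κ :=
  (Finsupp.linearCombination_apply ℕ κ).symm

omit [Fintype σ] [DecidableEq σ] [Fintype τ] [DecidableEq τ] in
/-- Additivity of `piT`. [folklore] -/
theorem piT_add (κ κ' : σ →₀ ℕ) : piT M (κ + κ') = piT M κ + piT M κ' := by
  simp only [piT_eq_linearCombination, map_add]

omit [Fintype σ] [DecidableEq σ] [Fintype τ] [DecidableEq τ] in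
/-- `piT` of a multiple. [folklore] -/
theorem piT_nsmul (k : ℕ) (κ : σ →₀ ℕ) : piT M (k • κ) = k • piT M κ := by
  simp only [piT_eq_linearCombination, map_nsmul]

omit [Fintype σ] [DecidableEq σ] [Fintype τ] [DecidableEq τ] in
/-- `piT` of a single letter. [folklore] -/
theorem piT_single (i : σ) (k : ℕ) : piT M (Finsupp.single i k) = k • M i := by
  unfold piT; rw [Finsupp.sum_single_index]; exact zero_smul _ _

omit [Fintype σ] [DecidableEq σ] [Fintype τ] [DecidableEq τ] in
/-- `phiT` on monomials. [folklore] -/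
theorem phiT_monomial (κ : σ →₀ ℕ) (a : ℂ) : phiT M (monomial κ a) = monomial (piT M κ) a := by
  unfold phiT piT
  rw [aeval_monomial, monomial_finsupp_sum_index, MvPolynomial.algebraMap_eq]
  congr 1
  refine Finsupp.prod_congr fun i _ => ?_
  rw [monomial_pow, one_pow]

omit [Fintype σ] [DecidableEq σ] [Fintype τ] [DecidableEq τ] in
/-- `phiT` on a variable. [folklore] -/
theorem phiT_X (i : σ) : phiT M (X i) = monomial (M i) 1 := by
  rw [show (X i : MvPolynomial σ ℂ) = monomial (Finsupp.single i 1) 1 from rfl, phiT_monomial, piT_single, one_smul]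

omit [Fintype σ] [DecidableEq σ] [Fintype τ] [DecidableEq τ] in
/-- `phiT` as a sum over the support. [folklore] -/
theorem phiT_eq_sum (H : MvPolynomial σ ℂ) : phiT M H = ∑ κ ∈ H.support, monomial (piT M κ) (coeff κ H) := by
  conv_lhs => rw [as_sum H]
  rw [map_sum]
  exact Finset.sum_congr rfl fun κ _ => phiT_monomial M κ _

omit [Fintype σ] [DecidableEq σ] [Fintype τ] in
/-- Coefficients of a push-forward are fibre sums. [folklore] -/
theorem coeff_phiT (H : MvPolynomial σ ℂ) (x : τ →₀ ℕ) :
    coeff x (phiT M H) = ∑ κ ∈ H.support with piT M κ = x, coeff κ H := by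
  classical
  rw [phiT_eq_sum, coeff_sum, Finset.sum_filter]
  refine Finset.sum_congr rfl fun κ _ => ?_
  rw [coeff_monomial]

omit [Fintype σ] [DecidableEq σ] [Fintype τ] in
/-- A support point of a push-forward has a preimage in the support. [folklore] -/
theorem exists_of_mem_support_phiT (H : MvPolynomial σ ℂ) (x : τ →₀ ℕ) (hx : x ∈ (phiT M H).support) :
    ∃ κ ∈ H.support, piT M κ = x := by
  classical
  rw [mem_support_iff, coeff_phiT] at hx
  obtain ⟨κ, hκ, -⟩ := Finset.exists_ne_zero_of_sum_ne_zero hx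
  exact ⟨κ, (Finset.mem_filter.mp hκ).1, (Finset.mem_filter.mp hκ).2⟩

omit [Fintype σ] [DecidableEq σ] [Fintype τ] [DecidableEq τ] in
/-- The planar push-forward `phi` is the case `τ = Fin 2` of `phiT`. [folklore] -/
theorem phi_eq_phiT (E : σ → (Fin 2 →₀ ℕ)) : phi E = phiT E := rfl

omit [Fintype σ] [DecidableEq σ] [Fintype τ] [DecidableEq τ] in
/-- `piE` is the case `τ = Fin 2` of `piT`. [folklore] -/
theorem piE_eq_piT (E : σ → (Fin 2 →₀ ℕ)) (κ : σ →₀ ℕ) : piE E κ = piT E κ := rfl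

omit [Fintype σ] [DecidableEq σ] [Fintype τ] [DecidableEq τ] in
/-- Composition of monomial substitutions on exponents. [folklore] -/
theorem piT_piT {υ : Type*} (N : τ → (υ →₀ ℕ)) (κ : σ →₀ ℕ) :
    piT N (piT M κ) = piT (fun i => piT N (M i)) κ := by
  simp only [piT_eq_linearCombination]
  rw [← LinearMap.comp_apply]
  congr 1
  ext i
  simp [Finsupp.linearCombination_single]

omit [Fintype σ] [DecidableEq σ] [Fintype τ] [DecidableEq τ] in
/-- Composition of monomial substitutions on polynomials. [folklore] -/
theorem phiT_phiT {υ : Type*} (N : τ → (υ →₀ ℕ)) (H : MvPolynomial σ ℂ) :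
    phiT N (phiT M H) = phiT (fun i => piT N (M i)) H := by
  have : (phiT N).comp (phiT M) = phiT (fun i => piT N (M i)) := by
    refine algHom_ext fun i => ?_
    rw [AlgHom.comp_apply, phiT_X, phiT_monomial, phiT_X]
  rw [← AlgHom.comp_apply, this]

end Toric

omit [DecidableEq σ] in
/-- Coordinates of a toric image, as a sum. [folklore] -/
theorem piT_apply {τ : Type*} (M : σ → (τ →₀ ℕ)) (L : σ →₀ ℕ) (j : τ) :
    piT M L j = ∑ i, L i * (M i) j := by
  rw [piT_eq_sum, Finsupp.coe_finset_sum, Finset.sum_apply]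
  simp only [Finsupp.coe_smul, Pi.smul_apply, smul_eq_mul]

/-! ## Part T2: three distinct indices and the FREE substitution `Y_a ↦ Y_b Y_c` (letter relation `α = β + γ`) -/

/-- Three distinct indices (of the relation letters `α = β + γ`). [folklore] -/
structure ThreeIdx (σ : Type*) where
  /-- index of `α` (idle upstairs) -/
  a : σ
  /-- index of `β` -/
  b : σ
  /-- index of `γ` (the slice coordinate) -/
  c : σ
  hab : a ≠ b
  hac : a ≠ c
  hbc : b ≠ c

variable (I : ThreeIdx σ)

/-- The free substitution on letters: `α ↦ β + γ`, all other letters unchanged. [folklore] -/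
def frM (i : σ) : σ →₀ ℕ :=
  if i = I.a then Finsupp.single I.b 1 + Finsupp.single I.c 1 else Finsupp.single i 1

omit [Fintype σ] in
theorem frM_a : frM I I.a = Finsupp.single I.b 1 + Finsupp.single I.c 1 := by
  unfold frM; rw [if_pos rfl]

omit [Fintype σ] in
theorem frM_other (i : σ) (ha : i ≠ I.a) : frM I i = Finsupp.single i 1 := by
  unfold frM; rw [if_neg ha]

omit [Fintype σ] in
theorem frM_ne_zero (i : σ) : frM I i ≠ 0 := by
  unfold frM
  split_ifs <;> intro h
  · have := DFunLike.congr_fun h I.b; simp [Finsupp.single_apply, I.hbc, I.hbc.symm] at this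
  · have := DFunLike.congr_fun h i; simp at this

/-- The `a`-coordinate of a toric image vanishes. [folklore] -/
theorem piT_frM_a (L : σ →₀ ℕ) : piT (frM I) L I.a = 0 := by
  have F := And.intro I.hab (And.intro I.hac I.hbc)
  rw [piT_apply]
  refine Finset.sum_eq_zero fun i _ => ?_
  unfold frM
  split_ifs with h1 <;>
    simp [Finsupp.single_apply, h1, F.1, F.2.1, F.2.2, F.1.symm, F.2.1.symm, F.2.2.symm]

/-- The `b`-coordinate of a toric image: `#α + #β`. [folklore] -/
theorem piT_frM_b (L : σ →₀ ℕ) : piT (frM I) L I.b = L I.a + L I.b := by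
  have F := And.intro I.hab (And.intro I.hac I.hbc)
  rw [piT_apply]
  have key : ∀ i, L i * (frM I i) I.b = (if i = I.a then L i else 0) + (if i = I.b then L i else 0) := by
    intro i
    unfold frM
    split_ifs with h1 h2 <;>
      simp [Finsupp.single_apply, F.1, F.2.1, F.2.2, F.1.symm, F.2.1.symm, F.2.2.symm] <;> simp_all
  simp only [key, Finset.sum_add_distrib, Finset.sum_ite_eq', Finset.mem_univ, if_true]

/-- The `c`-coordinate of a toric image: `#α + #γ`. [folklore] -/
theorem piT_frM_c (L : σ →₀ ℕ) : piT (frM I) L I.c = L I.a + L I.c := by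
  have F := And.intro I.hab (And.intro I.hac I.hbc)
  rw [piT_apply]
  have key : ∀ i, L i * (frM I i) I.c = (if i = I.a then L i else 0) + (if i = I.c then L i else 0) := by
    intro i
    unfold frM
    split_ifs with h1 h2 <;>
      simp [Finsupp.single_apply, F.1, F.2.1, F.2.2, F.1.symm, F.2.1.symm, F.2.2.symm] <;> simp_all
  simp only [key, Finset.sum_add_distrib, Finset.sum_ite_eq', Finset.mem_univ, if_true]

/-- Other coordinates of a toric image are unchanged. [folklore] -/
theorem piT_frM_other (L : σ →₀ ℕ) (j : σ) (ha : j ≠ I.a) (hb : j ≠ I.b) (hc : j ≠ I.c) : piT (frM I) L j = L j := by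
  have F := And.intro I.hab (And.intro I.hac I.hbc)
  rw [piT_apply]
  have key : ∀ i, L i * (frM I i) j = (if i = j then L i else 0) := by
    intro i
    unfold frM
    split_ifs with h1 h2 <;>
      simp [Finsupp.single_apply, ha, hb, hc, Ne.symm ha, Ne.symm hb, Ne.symm hc,
        F.1, F.2.1, F.2.2, F.1.symm, F.2.1.symm, F.2.2.symm] <;> simp_all
  simp only [key]
  rw [Finset.sum_ite_eq']; simp

/-! ## Part T3: the three special coordinates, reduced exponents, and the fibres of the free substitution -/

/-- The three relation indices as a finset. [folklore] -/
def threeSet : Finset σ := {I.a, I.b, I.c}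

/-- The remaining indices. [folklore] -/
def rest : Finset σ := Finset.univ \ threeSet I

theorem mem_rest (j : σ) : j ∈ rest I ↔ j ≠ I.a ∧ j ≠ I.b ∧ j ≠ I.c := by
  classical
  unfold rest threeSet
  simp only [Finset.mem_sdiff, Finset.mem_univ, true_and, Finset.mem_insert, Finset.mem_singleton, not_or]

/-- Splitting a product over `σ` into the three relation coordinates and the rest. [folklore] -/
theorem prod_three_split {β : Type*} [CommMonoid β] (f : σ → β) :
    ∏ j, f j = (∏ j ∈ rest I, f j) * (f I.a * (f I.b * f I.c)) := by
  classical
  unfold rest threeSet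
  rw [← Finset.prod_sdiff (Finset.subset_univ ({I.a, I.b, I.c} : Finset σ))]
  congr 1
  rw [Finset.prod_insert (by simp [I.hab, I.hac]), Finset.prod_pair I.hbc]

/-- Splitting a sum over `σ` into the three relation coordinates and the rest. [folklore] -/
theorem sum_three_split {β : Type*} [AddCommMonoid β] (f : σ → β) :
    ∑ j, f j = (∑ j ∈ rest I, f j) + (f I.a + (f I.b + f I.c)) := by
  classical
  unfold rest threeSet
  rw [← Finset.sum_sdiff (Finset.subset_univ ({I.a, I.b, I.c} : Finset σ))]
  congr 1
  rw [Finset.sum_insert (by simp [I.hab, I.hac]), Finset.sum_pair I.hbc]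

/-- A finitely supported function from its table of values (`σ` is finite). [folklore] -/
def ofFun (f : σ → ℕ) : σ →₀ ℕ := Finsupp.equivFunOnFinite.symm f

@[simp] theorem ofFun_apply (f : σ → ℕ) (j : σ) : ofFun f j = f j := by
  simp [ofFun]

/-- The reduced exponent `x̂`: the coordinates `a, c` set to zero. [folklore] -/
def xhat (x : σ →₀ ℕ) : σ →₀ ℕ := ofFun fun j => if j = I.a ∨ j = I.c then 0 else x j

theorem xhat_a (x : σ →₀ ℕ) : xhat I x I.a = 0 := by
  classical simp [xhat]

theorem xhat_b (x : σ →₀ ℕ) : xhat I x I.b = x I.b := by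
  classical simp [xhat, I.hab.symm, I.hbc]

theorem xhat_c (x : σ →₀ ℕ) : xhat I x I.c = 0 := by
  classical simp [xhat]

theorem xhat_other (x : σ →₀ ℕ) (j : σ) (ha : j ≠ I.a) (hc : j ≠ I.c) : xhat I x j = x j := by
  classical simp [xhat, ha, hc]

/-- The letter multiset in the fibre of the free substitution over `x` with `#α = k`:
`#α = k, #β = x b - k, #γ = x c - k`, other letters as in `x`. [folklore] -/
def Lof (x : σ →₀ ℕ) (k : ℕ) : σ →₀ ℕ :=
  ofFun fun j => if j = I.a then k else if j = I.b then x I.b - k else if j = I.c then x I.c - k else x j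

theorem Lof_a (x : σ →₀ ℕ) (k : ℕ) : Lof I x k I.a = k := by
  classical simp [Lof]

theorem Lof_b (x : σ →₀ ℕ) (k : ℕ) : Lof I x k I.b = x I.b - k := by
  classical simp [Lof, I.hab.symm]

theorem Lof_c (x : σ →₀ ℕ) (k : ℕ) : Lof I x k I.c = x I.c - k := by
  classical simp [Lof, I.hac.symm, I.hbc.symm]

theorem Lof_other (x : σ →₀ ℕ) (k : ℕ) (j : σ) (ha : j ≠ I.a) (hb : j ≠ I.b) (hc : j ≠ I.c) : Lof I x k j = x j := by
  classical simp [Lof, ha, hb, hc]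

/-- The admissible range of `k = #α` in the fibre over `x`. [folklore] -/
def KR (x : σ →₀ ℕ) : Finset ℕ := Finset.range (min (x I.b) (x I.c) + 1)

omit [Fintype σ] [DecidableEq σ] in
theorem mem_KR (x : σ →₀ ℕ) (k : ℕ) : k ∈ KR I x ↔ k ≤ x I.b ∧ k ≤ x I.c := by
  unfold KR; rw [Finset.mem_range, Nat.lt_succ_iff, le_min_iff]

/-- (F1) Every preimage of `x` is an `Lof x k` with `k` admissible (and `x a = 0`). [folklore] -/
theorem eq_Lof_of_piT (L x : σ →₀ ℕ) (h : piT (frM I) L = x) :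
    x I.a = 0 ∧ L I.a ∈ KR I x ∧ L = Lof I x (L I.a) := by
  have ha := piT_frM_a I L; have hb := piT_frM_b I L; have hc := piT_frM_c I L
  rw [h] at ha hb hc
  refine ⟨ha, (mem_KR I x _).2 ⟨by omega, by omega⟩, ?_⟩
  ext j
  by_cases hja : j = I.a
  · subst hja; rw [Lof_a]
  by_cases hjb : j = I.b
  · subst hjb; rw [Lof_b]; omega
  by_cases hjc : j = I.c
  · subst hjc; rw [Lof_c]; omega
  rw [Lof_other I x _ j hja hjb hjc, ← h, piT_frM_other I L j hja hjb hjc]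

/-- (F2) Every admissible `Lof x k` lies in the fibre over `x` (when `x a = 0`). [folklore] -/
theorem piT_Lof (x : σ →₀ ℕ) (hx : x I.a = 0) (k : ℕ) (hk : k ∈ KR I x) : piT (frM I) (Lof I x k) = x := by
  rw [mem_KR] at hk
  ext j
  by_cases hja : j = I.a
  · subst hja; rw [piT_frM_a, hx]
  by_cases hjb : j = I.b
  · subst hjb; rw [piT_frM_b, Lof_a, Lof_b]; omega
  by_cases hjc : j = I.c
  · subst hjc; rw [piT_frM_c, Lof_a, Lof_c]; omega
  rw [piT_frM_other I _ j hja hjb hjc, Lof_other I x k j hja hjb hjc]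

/-- The degree of the reduced exponent. [folklore] -/
theorem deg_xhat (x : σ →₀ ℕ) : deg (xhat I x) = (∑ j ∈ rest I, x j) + x I.b := by
  rw [deg_eq_sum, sum_three_split I, xhat_a, xhat_b, xhat_c, zero_add, add_zero]
  congr 1
  refine Finset.sum_congr rfl fun j hj => ?_
  rw [mem_rest] at hj
  rw [xhat_other I x j hj.1 hj.2.2]

/-- The full degree in terms of the reduced one. [folklore] -/
theorem deg_eq_deg_xhat_add (x : σ →₀ ℕ) : deg x = deg (xhat I x) + (x I.a + x I.c) := by
  rw [deg_xhat, deg_eq_sum, sum_three_split I]; ring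

/-- (F4) The degree along the fibre DROPS by `k`: `deg (Lof x k) + k = deg x̂ + x c`. [folklore] -/
theorem deg_Lof (x : σ →₀ ℕ) (k : ℕ) (hk : k ∈ KR I x) : deg (Lof I x k) + k = deg (xhat I x) + x I.c := by
  rw [mem_KR] at hk
  rw [deg_xhat, deg_eq_sum, sum_three_split I, Lof_a, Lof_b, Lof_c]
  have : ∑ j ∈ rest I, (Lof I x k) j = ∑ j ∈ rest I, x j := by
    refine Finset.sum_congr rfl fun j hj => ?_
    rw [mem_rest] at hj
    rw [Lof_other I x k j hj.1 hj.2.1 hj.2.2]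
  rw [this]; omega

/-- Multinomial coefficients over the whole (finite) index type. [folklore] -/
theorem multinomial_univ (f : σ →₀ ℕ) : f.multinomial = Nat.multinomial Finset.univ f := by
  classical
  rw [Finsupp.multinomial_eq]
  unfold Nat.multinomial
  rw [Finset.sum_subset (Finset.subset_univ _) (fun j _ hj => by simpa using hj),
    Finset.prod_subset (Finset.subset_univ _) (fun j _ hj => by
      rw [Finsupp.notMem_support_iff.mp hj, Nat.factorial_zero])]

/-- The slice normaliser `(deg x̂ - 1)! / (x_b! · ∏_rest x_j!)` (nonzero). [folklore] -/
def Pfac (x : σ →₀ ℕ) : ℂ :=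
  (((deg (xhat I x) - 1).factorial : ℕ) : ℂ) / ((((x I.b).factorial * ∏ j ∈ rest I, (x j).factorial : ℕ)) : ℂ)

theorem Pfac_ne_zero (x : σ →₀ ℕ) : Pfac I x ≠ 0 := by
  unfold Pfac
  refine div_ne_zero (Nat.cast_ne_zero.mpr (Nat.factorial_ne_zero _)) (Nat.cast_ne_zero.mpr ?_)
  exact Nat.mul_ne_zero (Nat.factorial_ne_zero _) (Finset.prod_ne_zero_iff.mpr fun j _ => Nat.factorial_ne_zero _)

/-- (F5) **Multinomial regrouping along the fibre** (varying letter count):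
`multinomial(L_k) / deg(L_k) = Pfac(x) · C(x_b, k) · C(deg x̂ + x_c - 1 - k, x_c - k)` for non-exceptional `x` (`deg x̂ ≥ 1`). [folklore] -/
theorem multinomial_Lof_div (x : σ →₀ ℕ) (k : ℕ) (hk : k ∈ KR I x) (h1 : 1 ≤ deg (xhat I x)) :
    ((Lof I x k).multinomial : ℂ) / ((deg (Lof I x k) : ℕ) : ℂ) =
      Pfac I x * (((x I.b).choose k * (deg (xhat I x) + x I.c - 1 - k).choose (x I.c - k) : ℕ) : ℂ) := by
  have hk' := (mem_KR I x k).1 hk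
  have hdeg := deg_Lof I x k hk
  set D := deg (xhat I x) with hD
  set n := deg (Lof I x k) with hn
  have sL := Nat.multinomial_spec (Finset.univ : Finset σ) (Lof I x k)
  rw [← multinomial_univ, ← deg_eq_sum] at sL
  rw [prod_three_split I, Lof_a, Lof_b, Lof_c] at sL
  have hr : ∏ j ∈ rest I, ((Lof I x k) j).factorial = ∏ j ∈ rest I, (x j).factorial := by
    refine Finset.prod_congr rfl fun j hj => ?_
    rw [mem_rest] at hj
    rw [Lof_other I x k j hj.1 hj.2.1 hj.2.2]
  rw [hr, ← hn] at sL
  -- factorial identities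
  have h1 : (x I.b).choose k * k.factorial * (x I.b - k).factorial = (x I.b).factorial :=
    Nat.choose_mul_factorial_mul_factorial hk'.1
  have h2 : (D + x I.c - 1 - k).choose (x I.c - k) * (x I.c - k).factorial * (D - 1).factorial =
      (D + x I.c - 1 - k).factorial := by
    have := Nat.choose_mul_factorial_mul_factorial (n := D + x I.c - 1 - k) (k := x I.c - k) (by omega)
    rwa [show D + x I.c - 1 - k - (x I.c - k) = D - 1 by omega] at this
  have h3 : n.factorial = n * (D + x I.c - 1 - k).factorial := by
    rw [show n = (D + x I.c - 1 - k) + 1 by omega, Nat.factorial_succ]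
  have hn0 : (n : ℂ) ≠ 0 := Nat.cast_ne_zero.mpr (by omega)
  have hden : ((((x I.b).factorial * ∏ j ∈ rest I, (x j).factorial : ℕ)) : ℂ) ≠ 0 :=
    Nat.cast_ne_zero.mpr (Nat.mul_ne_zero (Nat.factorial_ne_zero _)
      (Finset.prod_ne_zero_iff.mpr fun j _ => Nat.factorial_ne_zero _))
  have hbk : (((x I.c - k).factorial : ℕ) : ℂ) ≠ 0 := Nat.cast_ne_zero.mpr (Nat.factorial_ne_zero _)
  have key : ((Lof I x k).multinomial : ℂ) * ((∏ j ∈ rest I, (((x j).factorial : ℕ) : ℂ)) *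
      ((k.factorial : ℂ) * ((((x I.b - k).factorial : ℕ) : ℂ) * (((x I.c - k).factorial : ℕ) : ℂ)))) =
      (n : ℂ) * ((((D + x I.c - 1 - k).choose (x I.c - k) : ℕ) : ℂ) * (((x I.c - k).factorial : ℕ) : ℂ) *
        (((D - 1).factorial : ℕ) : ℂ)) := by
    have e : ((((∏ j ∈ rest I, (x j).factorial) * (k.factorial * ((x I.b - k).factorial * (x I.c - k).factorial)) *
        (Lof I x k).multinomial : ℕ)) : ℂ) = ((n.factorial : ℕ) : ℂ) := by exact_mod_cast sL
    rw [h3, ← h2] at e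
    push_cast at e
    linear_combination e
  unfold Pfac
  rw [div_mul_eq_mul_div, div_eq_div_iff hn0 hden]
  have e1 : (((x I.b).factorial : ℕ) : ℂ) = (((x I.b).choose k : ℕ) : ℂ) * (k.factorial : ℂ) * (((x I.b - k).factorial : ℕ) : ℂ) := by
    exact_mod_cast h1.symm
  push_cast
  rw [e1]
  apply mul_right_cancel₀ hbk
  linear_combination ((((x I.b).choose k : ℕ) : ℂ)) * key


/-- Fibre sums of the free substitution: `coeff_x (φ_M H) = Σ_{k ∈ KR x} coeff_{L_k} H` (for `x a = 0`). [folklore] -/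
theorem coeff_phiT_frM (H : MvPolynomial σ ℂ) (x : σ →₀ ℕ) (hx : x I.a = 0) :
    coeff x (phiT (frM I) H) = ∑ k ∈ KR I x, coeff (Lof I x k) H := by
  classical
  rw [coeff_phiT]
  rw [← Finset.sum_filter_add_sum_filter_not (KR I x) (fun k => Lof I x k ∈ H.support)]
  rw [Finset.sum_eq_zero (s := (KR I x).filter fun k => ¬ Lof I x k ∈ H.support)
    (fun k hk => notMem_support_iff.mp (Finset.mem_filter.mp hk).2), add_zero]
  apply Finset.sum_nbij' (fun L => L I.a) (fun k => Lof I x k)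
  · intro L hL
    rw [Finset.mem_filter] at hL
    obtain ⟨-, hk, hLeq⟩ := eq_Lof_of_piT I L x hL.2
    rw [Finset.mem_filter, ← hLeq]
    exact ⟨hk, hL.1⟩
  · intro k hk
    rw [Finset.mem_filter] at hk
    rw [Finset.mem_filter]
    exact ⟨hk.2, piT_Lof I x hx k hk.1⟩
  · intro L hL
    rw [Finset.mem_filter] at hL
    exact (eq_Lof_of_piT I L x hL.2).2.2.symm
  · intro k _
    exact Lof_a I x k
  · intro L hL
    rw [Finset.mem_filter] at hL
    obtain ⟨-, -, hLeq⟩ := eq_Lof_of_piT I L x hL.2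
    rw [← hLeq]

/-! ## Part T4: the slice functions `F_b` (NOT of bounded binomial width: the factor `C(λ(ν) + b - 1 - k, b - k)`) and THE
COEFFICIENT THEOREM for the free lift of the truncated logarithm -/

section Slice
variable {m : ℕ}

/-- The coefficient table of a signed atom. [folklore] -/
def tab (c d : Fin m → σ → ℂ) : Fin m ⊕ Fin m → σ → ℂ := Sum.elim c d

/-- The sign of a signed atom. [folklore] -/
def sgn (m : ℕ) : Fin m ⊕ Fin m → ℂ := Sum.elim (fun _ => 1) (fun _ => -1)

omit [Fintype σ] [DecidableEq σ] in
theorem sum_sgn : ∑ j, sgn m j = 0 := by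
  rw [Fintype.sum_sum_type]; simp [sgn]

/-- The binomial character `ν ↦ C(ν, d) · a ^ (ν - d)`. [folklore] -/
def binChar (a : ℂ) (d ν : ℕ) : ℂ := (Nat.choose ν d : ℂ) * a ^ (ν - d)

omit [Fintype σ] [DecidableEq σ] in
theorem binChar_zero_deg (a : ℂ) (ν : ℕ) : binChar a 0 ν = a ^ ν := by
  simp [binChar]

omit [Fintype σ] [DecidableEq σ] in
theorem binChar_eq_zero_of_lt (a : ℂ) (d ν : ℕ) (h : ν < d) : binChar a d ν = 0 := by
  simp [binChar, Nat.choose_eq_zero_of_lt h]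

/-- The slice indicator `[ν_a = 0] [ν_c = 0]`. [folklore] -/
def ind (ν : σ → ℕ) : ℂ := if ν I.a = 0 ∧ ν I.c = 0 then 1 else 0

/-- The ADDITIVE letter-count form `λ(ν) = Σ_{j ∉ {a, c}} ν_j`. [folklore] -/
def lam (ν : σ → ℕ) : ℕ := (∑ j ∈ rest I, ν j) + ν I.b

/-- The exponential factor over the untouched letters. [folklore] -/
def restProd (t : σ → ℂ) (ν : σ → ℕ) : ℂ := ∏ j ∈ rest I, t j ^ ν j

/-- The `(j, k)` term of the slice function `F_b`:
`± (-1)^k c_{jα}^k c_{jγ}^{b-k} · C(ν_β, k) c_{jβ}^{ν_β - k} · ∏_rest c_{je}^{ν_e} · C(λ(ν) + b - 1 - k, b - k)`. [folklore] -/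
def mainTerm (c d : Fin m → σ → ℂ) (b₀ : ℕ) (j : Fin m ⊕ Fin m) (k : ℕ) (ν : σ → ℕ) : ℂ :=
  (sgn m j * (-1) ^ k * tab c d j I.a ^ k * tab c d j I.c ^ (b₀ - k)) *
    ((binChar (tab c d j I.b) k (ν I.b) * restProd I (tab c d j) ν) *
      (((lam I ν + (b₀ - 1 - k)).choose (b₀ - k) : ℕ) : ℂ))

/-- The correction at the exceptional point `ν = 0` of the slice (the pure power `Y_γ^b`). [folklore] -/
def corr (c d : Fin m → σ → ℂ) (b₀ : ℕ) (ν : σ → ℕ) : ℂ :=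
  if (∀ j, ν j = 0) then ∑ j, sgn m j * tab c d j I.c ^ b₀ else 0

/-- **The slice function** `F_b` of the free lift of the truncated logarithm. [folklore] -/
def Fsl (c d : Fin m → σ → ℂ) (b₀ : ℕ) (ν : σ → ℕ) : ℂ :=
  ind I ν * (∑ j : Fin m ⊕ Fin m, ∑ k : Fin (b₀ + 1), mainTerm I c d b₀ j k ν) + corr I c d b₀ ν

theorem lam_xhat (x : σ →₀ ℕ) : lam I ⇑(xhat I x) = deg (xhat I x) := by
  rw [deg_xhat]; unfold lam
  rw [xhat_b]
  congr 1
  refine Finset.sum_congr rfl fun j hj => ?_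
  rw [mem_rest] at hj
  exact xhat_other I x j hj.1 hj.2.2

theorem restProd_xhat (t : σ → ℂ) (x : σ →₀ ℕ) : restProd I t ⇑(xhat I x) = ∏ j ∈ rest I, t j ^ x j := by
  unfold restProd
  refine Finset.prod_congr rfl fun j hj => ?_
  rw [mem_rest] at hj
  rw [xhat_other I x j hj.1 hj.2.2]

theorem mom_Lof (t : σ → ℂ) (x : σ →₀ ℕ) (k : ℕ) :
    mom t (Lof I x k) = (∏ j ∈ rest I, t j ^ x j) * (t I.a ^ k * (t I.b ^ (x I.b - k) * t I.c ^ (x I.c - k))) := by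
  unfold mom
  rw [prod_three_split I, Lof_a, Lof_b, Lof_c]
  congr 1
  refine Finset.prod_congr rfl fun j hj => ?_
  rw [mem_rest] at hj
  rw [Lof_other I x k j hj.1 hj.2.1 hj.2.2]

theorem ind_xhat (x : σ →₀ ℕ) : ind I ⇑(xhat I x) = 1 := by
  unfold ind; rw [xhat_a, xhat_c, if_pos ⟨rfl, rfl⟩]

theorem corr_xhat (c d : Fin m → σ → ℂ) (b₀ : ℕ) (x : σ →₀ ℕ) (h1 : 1 ≤ deg (xhat I x)) :
    corr I c d b₀ ⇑(xhat I x) = 0 := by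
  unfold corr
  rw [if_neg]
  intro h
  have : xhat I x = 0 := by ext j; exact h j
  rw [this] at h1
  simp [deg_eq_sum] at h1

/-- **Per-term evaluation** of the slice function at a reduced exponent. [folklore] -/
theorem mainTerm_xhat (c d : Fin m → σ → ℂ) (x : σ →₀ ℕ) (j : Fin m ⊕ Fin m) (k : ℕ) :
    mainTerm I c d (x I.c) j k ⇑(xhat I x) = sgn m j * (((-1 : ℂ) ^ k *
      (((x I.b).choose k * (deg (xhat I x) + (x I.c - 1 - k)).choose (x I.c - k) : ℕ) : ℂ)) *
        mom (tab c d j) (Lof I x k)) := by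
  unfold mainTerm binChar
  rw [xhat_b, lam_xhat, restProd_xhat, mom_Lof]
  push_cast
  ring

/-- **The slice function at a reduced exponent** is the signed-binomially weighted fibre sum of moment differences. [folklore] -/
theorem Fsl_xhat_eq (c d : Fin m → σ → ℂ) (x : σ →₀ ℕ) (h1 : 1 ≤ deg (xhat I x)) :
    Fsl I c d (x I.c) ⇑(xhat I x) = ∑ k ∈ Finset.range (x I.c + 1),
      ((-1 : ℂ) ^ k * (((x I.b).choose k * (deg (xhat I x) + (x I.c - 1 - k)).choose (x I.c - k) : ℕ) : ℂ)) *
        (∑ j, mom (c j) (Lof I x k) - ∑ j, mom (d j) (Lof I x k)) := by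
  unfold Fsl
  rw [ind_xhat, one_mul, corr_xhat I c d _ x h1, add_zero, Finset.sum_comm]
  rw [← Fin.sum_univ_eq_sum_range (fun k => ((-1 : ℂ) ^ k *
      (((x I.b).choose k * (deg (xhat I x) + (x I.c - 1 - k)).choose (x I.c - k) : ℕ) : ℂ)) *
        (∑ j, mom (c j) (Lof I x k) - ∑ j, mom (d j) (Lof I x k))) (x I.c + 1)]
  refine Finset.sum_congr rfl fun k _ => ?_
  simp only [mainTerm_xhat]
  rw [Fintype.sum_sum_type]
  simp only [sgn, tab, Sum.elim_inl, Sum.elim_inr, one_mul, neg_one_mul, Finset.sum_neg_distrib,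
    ← Finset.mul_sum]
  unfold mom
  ring

omit [Fintype σ] [DecidableEq σ] in
theorem KR_subset_range (x : σ →₀ ℕ) : KR I x ⊆ Finset.range (x I.c + 1) := by
  intro k hk
  rw [mem_KR] at hk
  exact Finset.mem_range.mpr (by omega)

omit [Fintype σ] [DecidableEq σ] in
/-- The two spellings of the letter-count binomial agree on the admissible range. [folklore] -/
theorem choose_bridge (D xc k : ℕ) (hk : k ≤ xc) (hD : 1 ≤ D) :
    (D + (xc - 1 - k)).choose (xc - k) = (D + xc - 1 - k).choose (xc - k) := by
  rcases Nat.lt_or_ge k xc with h | h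
  · congr 1; omega
  · have h0 : xc - k = 0 := by omega
    rw [h0, Nat.choose_zero_right, Nat.choose_zero_right]

/-- **THE COEFFICIENT THEOREM** (non-exceptional exponents, `deg x̂ ≥ 1`): for `x` with `x_a = 0` and `deg x ≤ R`, the coefficient of
`Y^x` in the free lift of the truncated logarithm is `(-1)^{deg x + 1} · Pfac(x) · F_{x_c}(x̂)`. [folklore] -/
theorem coeff_free_logTrunc (c d : Fin m → σ → ℂ) (R : ℕ) (x : σ →₀ ℕ) (hx : x I.a = 0)
    (h1 : 1 ≤ deg (xhat I x)) (hR : deg x ≤ R) :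
    coeff x (phiT (frM I) (logTrunc c d R)) = (-1 : ℂ) ^ (deg x + 1) * Pfac I x * Fsl I c d (x I.c) ⇑(xhat I x) := by
  classical
  rw [coeff_phiT_frM I _ x hx]
  have hdx : deg x = deg (xhat I x) + x I.c := by rw [deg_eq_deg_xhat_add I x, hx, zero_add]
  have step2 : ∀ k ∈ KR I x, coeff (Lof I x k) (logTrunc c d R) =
      (-1 : ℂ) ^ (deg x + 1) * Pfac I x * (((-1 : ℂ) ^ k *
        (((x I.b).choose k * (deg (xhat I x) + (x I.c - 1 - k)).choose (x I.c - k) : ℕ) : ℂ)) *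
          (∑ j, mom (c j) (Lof I x k) - ∑ j, mom (d j) (Lof I x k))) := by
    intro k hk
    have hk' := (mem_KR I x k).1 hk
    have hdeg := deg_Lof I x k hk
    have hdeg1 : 1 ≤ deg (Lof I x k) := by omega
    have hdegR : deg (Lof I x k) ≤ R := by omega
    rw [coeff_logTrunc c d R _ hdeg1 hdegR]
    have hsign : (-1 : ℂ) ^ (deg (Lof I x k) + 1) = (-1) ^ (deg x + 1) * (-1) ^ k := by
      have e : deg x + 1 = (deg (Lof I x k) + 1) + k := by omega
      rw [e, pow_add (-1 : ℂ) (deg (Lof I x k) + 1) k, mul_assoc, ← pow_add (-1 : ℂ) k k, ← two_mul,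
        pow_mul]
      norm_num
    have hn0 : ((deg (Lof I x k) : ℕ) : ℂ) ≠ 0 := Nat.cast_ne_zero.mpr (by omega)
    have hM : ((Lof I x k).multinomial : ℂ) = Pfac I x *
        (((x I.b).choose k * (deg (xhat I x) + x I.c - 1 - k).choose (x I.c - k) : ℕ) : ℂ) *
          ((deg (Lof I x k) : ℕ) : ℂ) := (div_eq_iff hn0).mp (multinomial_Lof_div I x k hk h1)
    rw [← choose_bridge (deg (xhat I x)) (x I.c) k hk'.2 h1] at hM
    rw [hM, hsign]
    field_simp
  rw [Finset.sum_congr rfl step2, ← Finset.mul_sum, Fsl_xhat_eq I c d x h1]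
  rw [← Finset.sum_subset (KR_subset_range I x) (fun k hk hnk => by
    rw [mem_KR] at hnk
    have hk' : k ≤ x I.c := Nat.lt_succ_iff.mp (Finset.mem_range.mp hk)
    have : (x I.b).choose k * (deg (xhat I x) + (x I.c - 1 - k)).choose (x I.c - k) = 0 := by
      rw [Nat.choose_eq_zero_of_lt (by omega : x I.b < k), zero_mul]
    rw [this, Nat.cast_zero, mul_zero, zero_mul])]

theorem Lof_zero (x : σ →₀ ℕ) (hx : x I.a = 0) : Lof I x 0 = x := by
  ext j
  by_cases hja : j = I.a
  · subst hja; rw [Lof_a, hx]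
  by_cases hjb : j = I.b
  · subst hjb; rw [Lof_b, Nat.sub_zero]
  by_cases hjc : j = I.c
  · subst hjc; rw [Lof_c, Nat.sub_zero]
  rw [Lof_other I x 0 j hja hjb hjc]

/-- The exceptional exponents of a slice: `x̂ = 0`, i.e. `x = b · e_c`. [folklore] -/
theorem exc_apply (x : σ →₀ ℕ) (hx : x I.a = 0) (h0 : deg (xhat I x) = 0) (j : σ) (hj : j ≠ I.c) : x j = 0 := by
  have hz : xhat I x = 0 := (deg_eq_zero_iff _).mp h0
  by_cases hja : j = I.a
  · rw [hja, hx]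
  · have := DFunLike.congr_fun hz j
    rwa [xhat_other I x j hja hj] at this

theorem multinomial_exc (x : σ →₀ ℕ) (hx : x I.a = 0) (h0 : deg (xhat I x) = 0) : x.multinomial = 1 := by
  have s := Nat.multinomial_spec (Finset.univ : Finset σ) x
  rw [← multinomial_univ, ← deg_eq_sum, prod_three_split I, hx, exc_apply I x hx h0 I.b I.hbc,
    deg_eq_deg_xhat_add I x, h0, hx] at s
  have hr : ∏ j ∈ rest I, (x j).factorial = 1 := by
    refine Finset.prod_eq_one fun j hj => ?_
    rw [mem_rest] at hj
    rw [exc_apply I x hx h0 j hj.2.2, Nat.factorial_zero]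
  rw [hr, Nat.factorial_zero] at s
  have hpos : 0 < (x I.c).factorial := Nat.factorial_pos _
  apply Nat.eq_of_mul_eq_mul_left hpos
  simpa using s

theorem mom_exc (t : σ → ℂ) (x : σ →₀ ℕ) (hx : x I.a = 0) (h0 : deg (xhat I x) = 0) : mom t x = t I.c ^ x I.c := by
  unfold mom
  rw [prod_three_split I, hx, exc_apply I x hx h0 I.b I.hbc, pow_zero, pow_zero, one_mul, one_mul]
  have hr : ∏ j ∈ rest I, t j ^ x j = 1 := by
    refine Finset.prod_eq_one fun j hj => ?_
    rw [mem_rest] at hj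
    rw [exc_apply I x hx h0 j hj.2.2, pow_zero]
  rw [hr, one_mul]

/-- The slice function at the exceptional point: `F_b(0) = Σ_j ± c_{jγ}^b` for `b ≥ 1`. [folklore] -/
theorem Fsl_exc (c d : Fin m → σ → ℂ) (b₀ : ℕ) (hb : 1 ≤ b₀) (ν : σ → ℕ) (hν : ∀ j, ν j = 0) :
    Fsl I c d b₀ ν = ∑ j, mom (c j) (ofFun fun i => if i = I.c then b₀ else 0) -
      ∑ j, mom (d j) (ofFun fun i => if i = I.c then b₀ else 0) := by
  have hmain : ∑ j : Fin m ⊕ Fin m, ∑ k : Fin (b₀ + 1), mainTerm I c d b₀ j k ν = 0 := by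
    refine Finset.sum_eq_zero fun j _ => Finset.sum_eq_zero fun k _ => ?_
    unfold mainTerm
    rcases Nat.eq_zero_or_pos (k : ℕ) with hk | hk
    · have hlam : lam I ν = 0 := by unfold lam; simp [hν]
      rw [hk, hlam, Nat.choose_eq_zero_of_lt (by omega : 0 + (b₀ - 1 - 0) < b₀ - 0)]
      simp
    · rw [hν I.b, binChar_eq_zero_of_lt _ _ _ hk]
      simp
  have hmom : ∀ t : σ → ℂ, mom t (ofFun fun i => if i = I.c then b₀ else 0) = t I.c ^ b₀ := by
    intro t
    unfold mom
    rw [prod_three_split I]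
    have hr : ∏ j ∈ rest I, t j ^ (ofFun fun i => if i = I.c then b₀ else 0) j = 1 := by
      refine Finset.prod_eq_one fun j hj => ?_
      rw [mem_rest] at hj
      simp [hj.2.2]
    rw [hr]
    simp [I.hac, I.hbc]
  unfold Fsl
  rw [hmain, mul_zero, zero_add]
  unfold corr
  rw [if_pos hν, Fintype.sum_sum_type]
  simp only [sgn, tab, Sum.elim_inl, Sum.elim_inr, one_mul, neg_one_mul, Finset.sum_neg_distrib, hmom]
  ring

/-- **THE COEFFICIENT THEOREM at the exceptional exponent** `x = b · e_c` (`b ≥ 1`). [folklore] -/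
theorem coeff_free_logTrunc_exc (c d : Fin m → σ → ℂ) (R : ℕ) (x : σ →₀ ℕ) (hx : x I.a = 0)
    (h0 : deg (xhat I x) = 0) (hc : 1 ≤ x I.c) (hR : deg x ≤ R) :
    coeff x (phiT (frM I) (logTrunc c d R)) =
      ((-1 : ℂ) ^ (x I.c + 1) / ((x I.c : ℕ) : ℂ)) * Fsl I c d (x I.c) ⇑(xhat I x) := by
  classical
  rw [coeff_phiT_frM I _ x hx]
  have hdx : deg x = x I.c := by rw [deg_eq_deg_xhat_add I x, hx, h0, zero_add, zero_add]
  have hKR : KR I x = {0} := by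
    unfold KR; rw [exc_apply I x hx h0 I.b I.hbc, Nat.zero_min, zero_add, Finset.range_one]
  rw [hKR, Finset.sum_singleton, Lof_zero I x hx, coeff_logTrunc c d R x (by omega) hR, hdx, multinomial_exc I x hx h0,
    Nat.cast_one, one_mul]
  have hz : ∀ j, (xhat I x) j = 0 := fun j => by rw [(deg_eq_zero_iff _).mp h0]; rfl
  rw [Fsl_exc I c d (x I.c) hc _ hz]
  have hxe : x = ofFun fun i => if i = I.c then x I.c else 0 := by
    ext j
    by_cases hj : j = I.c
    · subst hj; simp
    · rw [exc_apply I x hx h0 j hj]; simp [hj]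
  rw [← hxe]

/-- **The support criterion**: `x ≠ 0` with `x_a = 0` and `deg x ≤ R` lies in the support of the free lift of `Λ_R` iff
`F_{x_c}(x̂) ≠ 0`. [folklore] -/
theorem mem_support_free_logTrunc_iff (c d : Fin m → σ → ℂ) (R : ℕ) (x : σ →₀ ℕ) (hx : x I.a = 0) (hne : x ≠ 0)
    (hR : deg x ≤ R) :
    x ∈ (phiT (frM I) (logTrunc c d R)).support ↔ Fsl I c d (x I.c) ⇑(xhat I x) ≠ 0 := by
  rw [mem_support_iff]
  by_cases h1 : 1 ≤ deg (xhat I x)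
  · rw [coeff_free_logTrunc I c d R x hx h1 hR]
    have hc : (-1 : ℂ) ^ (deg x + 1) * Pfac I x ≠ 0 :=
      mul_ne_zero (pow_ne_zero _ (neg_ne_zero.mpr one_ne_zero)) (Pfac_ne_zero I x)
    constructor
    · intro h hF; exact h (by rw [hF, mul_zero])
    · intro h; exact mul_ne_zero hc h
  · have h0 : deg (xhat I x) = 0 := by omega
    have hdx : deg x = x I.c := by rw [deg_eq_deg_xhat_add I x, hx, h0, zero_add, zero_add]
    have hc1 : 1 ≤ x I.c := by
      by_contra h
      apply hne
      apply (deg_eq_zero_iff x).mp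
      omega
    rw [coeff_free_logTrunc_exc I c d R x hx h0 hc1 hR]
    have hc : ((-1 : ℂ) ^ (x I.c + 1) / ((x I.c : ℕ) : ℂ)) ≠ 0 :=
      div_ne_zero (pow_ne_zero _ (neg_ne_zero.mpr one_ne_zero)) (Nat.cast_ne_zero.mpr (by omega))
    constructor
    · intro h hF; exact h (by rw [hF, mul_zero])
    · intro h; exact mul_ne_zero hc h

/-- Non-vanishing of a slice function forces `ν_a = ν_c = 0`. [folklore] -/
theorem shape_of_Fsl_ne_zero (c d : Fin m → σ → ℂ) (b₀ : ℕ) (ν : σ → ℕ) (h : Fsl I c d b₀ ν ≠ 0) :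
    ν I.a = 0 ∧ ν I.c = 0 := by
  by_contra hcon
  apply h
  unfold Fsl ind corr
  rw [if_neg hcon, zero_mul, zero_add, if_neg]
  intro hall
  exact hcon ⟨hall I.a, hall I.c⟩

/-- The slice function of the slice `b = 0` vanishes at the origin (equal numbers of `±` atoms). [folklore] -/
theorem Fsl_zero_zero (c d : Fin m → σ → ℂ) (ν : σ → ℕ) (hν : ∀ j, ν j = 0) : Fsl I c d 0 ν = 0 := by
  have hmain : ∀ j : Fin m ⊕ Fin m, ∑ k : Fin (0 + 1), mainTerm I c d 0 j k ν = sgn m j := by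
    intro j
    rw [Fin.sum_univ_one]
    unfold mainTerm binChar restProd
    simp [hν]
  unfold Fsl corr
  simp only [hmain, sum_sgn, mul_zero, zero_add]
  rw [if_pos hν]
  simp only [pow_zero, mul_one, sum_sgn]

/-- The exponent with prescribed slice `b` and reduced part `ν` (`ν_a = ν_c = 0`). [folklore] -/
def xOf (b₀ : ℕ) (ν : σ → ℕ) : σ →₀ ℕ :=
  ofFun fun j => if j = I.c then b₀ else if j = I.a then 0 else ν j

theorem xOf_c (b₀ : ℕ) (ν : σ → ℕ) : xOf I b₀ ν I.c = b₀ := by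
  simp [xOf]

theorem xOf_a (b₀ : ℕ) (ν : σ → ℕ) : xOf I b₀ ν I.a = 0 := by
  simp [xOf, I.hac]

theorem xhat_xOf (b₀ : ℕ) (ν : σ → ℕ) (ha : ν I.a = 0) (hc : ν I.c = 0) : ⇑(xhat I (xOf I b₀ ν)) = ν := by
  funext j
  by_cases hja : j = I.a
  · subst hja; rw [xhat_a, ha]
  by_cases hjc : j = I.c
  · subst hjc; rw [xhat_c, hc]
  rw [xhat_other I _ j hja hjc]
  simp [xOf, hja, hjc]

theorem xOf_xhat (x : σ →₀ ℕ) (hx : x I.a = 0) : xOf I (x I.c) ⇑(xhat I x) = x := by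
  ext j
  by_cases hjc : j = I.c
  · subst hjc; rw [xOf_c]
  by_cases hja : j = I.a
  · subst hja; rw [xOf_a, hx]
  simp [xOf, hjc, hja, xhat_other I x j hja hjc]

end Slice

/-! ## Part T5: finite SHIFT RANK of the slice functions (`F(β + w) = Σ_{ι} col_β(ι) · ch_ι(w)`, `|ι| = 2m(b+1)^3 + 1`) — the
hypothesis of val-lit-p3's `ShiftRank.pencilCount` -/

section ShiftDecomp

/-- A finite shift decomposition of a function on `ℕ^σ`, indexed by `ι`. [folklore] -/
def HSD (ι : Type*) [Fintype ι] (F : (σ → ℕ) → ℂ) : Prop :=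
  ∃ (col : (σ → ℕ) → ι → ℂ) (ch : ι → (σ → ℕ) → ℂ), ∀ β w : σ → ℕ, F (β + w) = ∑ i, col β i * ch i w

omit [Fintype σ] [DecidableEq σ] in
theorem HSD.mul {ι κ : Type*} [Fintype ι] [Fintype κ] {F G : (σ → ℕ) → ℂ} (hF : HSD ι F) (hG : HSD κ G) :
    HSD (ι × κ) (fun ν => F ν * G ν) := by
  obtain ⟨col, ch, hF⟩ := hF
  obtain ⟨col', ch', hG⟩ := hG
  refine ⟨fun β p => col β p.1 * col' β p.2, fun p w => ch p.1 w * ch' p.2 w, fun β w => ?_⟩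
  simp only [hF, hG, Finset.sum_mul_sum, Fintype.sum_prod_type]
  exact Finset.sum_congr rfl fun i _ => Finset.sum_congr rfl fun k _ => by ring

omit [Fintype σ] [DecidableEq σ] in
theorem HSD.mulHom {ι : Type*} [Fintype ι] {F G : (σ → ℕ) → ℂ} (hF : HSD ι F)
    (hG : ∀ β w : σ → ℕ, G (β + w) = G β * G w) : HSD ι (fun ν => F ν * G ν) := by
  obtain ⟨col, ch, hF⟩ := hF
  refine ⟨fun β i => col β i * G β, fun i w => ch i w * G w, fun β w => ?_⟩
  simp only [hF, hG, Finset.sum_mul]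
  exact Finset.sum_congr rfl fun i _ => by ring

omit [Fintype σ] [DecidableEq σ] in
theorem HSD.homMul {ι : Type*} [Fintype ι] {F G : (σ → ℕ) → ℂ} (hG : ∀ β w : σ → ℕ, G (β + w) = G β * G w)
    (hF : HSD ι F) : HSD ι (fun ν => G ν * F ν) := by
  obtain ⟨col, ch, hF⟩ := hF
  refine ⟨fun β i => G β * col β i, fun i w => G w * ch i w, fun β w => ?_⟩
  simp only [hF, hG, Finset.mul_sum]
  exact Finset.sum_congr rfl fun i _ => by ring

omit [Fintype σ] [DecidableEq σ] in
theorem HSD.constMul {ι : Type*} [Fintype ι] {F : (σ → ℕ) → ℂ} (a : ℂ) (hF : HSD ι F) : HSD ι (fun ν => a * F ν) := by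
  obtain ⟨col, ch, hF⟩ := hF
  refine ⟨fun β i => a * col β i, ch, fun β w => ?_⟩
  simp only [hF, Finset.mul_sum]
  exact Finset.sum_congr rfl fun i _ => by ring

omit [Fintype σ] [DecidableEq σ] in
theorem HSD.sum {π ι : Type*} [Fintype π] [Fintype ι] (F : π → (σ → ℕ) → ℂ) (h : ∀ p, HSD ι (F p)) :
    HSD (π × ι) (fun ν => ∑ p, F p ν) := by
  choose col ch hcol using h
  refine ⟨fun β q => col q.1 β q.2, fun q w => ch q.1 q.2 w, fun β w => ?_⟩
  simp only [hcol, Fintype.sum_prod_type]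

omit [Fintype σ] [DecidableEq σ] in
theorem HSD.add {ι κ : Type*} [Fintype ι] [Fintype κ] {F G : (σ → ℕ) → ℂ} (hF : HSD ι F) (hG : HSD κ G) :
    HSD (ι ⊕ κ) (fun ν => F ν + G ν) := by
  obtain ⟨col, ch, hF⟩ := hF
  obtain ⟨col', ch', hG⟩ := hG
  refine ⟨fun β i => Sum.elim (col β) (col' β) i, fun i w => Sum.elim (fun i => ch i w) (fun k => ch' k w) i,
    fun β w => ?_⟩
  simp only [hF, hG, Fintype.sum_sum_type, Sum.elim_inl, Sum.elim_inr]

omit [Fintype σ] [DecidableEq σ] in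
/-- Binomial characters have shift rank `k + 1` (Vandermonde; val-lit-p3's `BinExpSum.binChar_add`). [folklore] -/
theorem hsd_binChar (t : ℂ) (k b₀ : ℕ) (hk : k ≤ b₀) (i₀ : σ) :
    HSD (Fin (b₀ + 1)) (fun ν : σ → ℕ => binChar t k (ν i₀)) := by
  refine ⟨fun β p => if (p : ℕ) ≤ k then binChar t p (β i₀) else 0, fun p w => binChar t (k - p) (w i₀),
    fun β w => ?_⟩
  have h := Summit.ValiantsHypothesis.ValiantsHypothesis.Theorems.NewtonUnitEquations.TwoProducts.FormalLogLinearisation.BinExpSum.binChar_add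
    t k (β i₀) (w i₀)
  simp only [Pi.add_apply]
  unfold binChar
  rw [h, Fin.sum_univ_eq_sum_range (fun p => (if p ≤ k then ((((β i₀).choose p : ℕ) : ℂ) * t ^ (β i₀ - p)) else 0) *
      ((((w i₀).choose (k - p) : ℕ) : ℂ) * t ^ (w i₀ - (k - p)))) (b₀ + 1)]
  simp_rw [ite_mul, zero_mul]
  rw [← Finset.sum_filter]
  congr 1
  ext p
  simp only [Finset.mem_range, Finset.mem_filter]
  omega

theorem lam_add (β w : σ → ℕ) : lam I (β + w) = lam I β + lam I w := by
  unfold lam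
  simp only [Pi.add_apply, Finset.sum_add_distrib]
  ring

/-- Binomial coefficients of the additive form `λ` have shift rank `d + 1` (Vandermonde). [folklore] -/
theorem hsd_choose (e d b₀ : ℕ) (hd : d ≤ b₀) :
    HSD (Fin (b₀ + 1)) (fun ν : σ → ℕ => (((lam I ν + e).choose d : ℕ) : ℂ)) := by
  refine ⟨fun β p => if (p : ℕ) ≤ d then (((lam I β + e).choose p : ℕ) : ℂ) else 0,
    fun p w => (((lam I w).choose (d - p) : ℕ) : ℂ), fun β w => ?_⟩
  have hnat : (lam I β + e + lam I w).choose d =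
      ∑ p ∈ Finset.range (d + 1), (lam I β + e).choose p * (lam I w).choose (d - p) := by
    have h := Finset.Nat.sum_antidiagonal_eq_sum_range_succ
      (fun p q => (lam I β + e).choose p * (lam I w).choose q) d
    rw [Nat.succ_eq_add_one] at h
    rw [← h, Nat.add_choose_eq]
  simp only
  rw [lam_add, show lam I β + lam I w + e = lam I β + e + lam I w by ring, hnat]
  push_cast
  rw [Fin.sum_univ_eq_sum_range (fun p => (if p ≤ d then (((lam I β + e).choose p : ℕ) : ℂ) else 0) *
      (((lam I w).choose (d - p) : ℕ) : ℂ)) (b₀ + 1)]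
  simp_rw [ite_mul, zero_mul]
  rw [← Finset.sum_filter]
  congr 1
  ext p
  simp only [Finset.mem_range, Finset.mem_filter]
  omega

theorem restProd_add (t : σ → ℂ) (β w : σ → ℕ) : restProd I t (β + w) = restProd I t β * restProd I t w := by
  unfold restProd
  rw [← Finset.prod_mul_distrib]
  exact Finset.prod_congr rfl fun j _ => by rw [Pi.add_apply, pow_add]

theorem ind_add (β w : σ → ℕ) : ind I (β + w) = ind I β * ind I w := by
  unfold ind
  simp only [Pi.add_apply]
  by_cases hβ : β I.a = 0 ∧ β I.c = 0 <;> by_cases hw : w I.a = 0 ∧ w I.c = 0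
  · rw [if_pos hβ, if_pos hw, if_pos ⟨by omega, by omega⟩, mul_one]
  · rw [if_pos hβ, if_neg hw, if_neg (fun h => hw ⟨by omega, by omega⟩), mul_zero]
  · rw [if_neg hβ, if_neg (fun h => hβ ⟨by omega, by omega⟩), zero_mul]
  · rw [if_neg hβ, if_neg (fun h => hβ ⟨by omega, by omega⟩), zero_mul]

variable {m : ℕ}

theorem corr_hsd (c d : Fin m → σ → ℂ) (b₀ : ℕ) : HSD Unit (corr I c d b₀) := by
  refine ⟨fun β _ => corr I c d b₀ β, fun _ w => if (∀ j, w j = 0) then 1 else 0, fun β w => ?_⟩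
  rw [Fintype.sum_unique]
  dsimp only
  unfold corr
  by_cases hβ : ∀ j, β j = 0
  · by_cases hw : ∀ j, w j = 0
    · rw [if_pos hw, if_pos hβ, mul_one, if_pos]
      intro j; rw [Pi.add_apply, hβ j, hw j]
    · rw [if_neg hw, mul_zero, if_neg]
      intro h; apply hw; intro j; have := h j; rw [Pi.add_apply] at this; omega
  · rw [if_neg hβ, zero_mul, if_neg]
    intro h; apply hβ; intro j; have := h j; rw [Pi.add_apply] at this; omega

/-- Each `(j, k)` term has shift rank `≤ (b + 1)^2`. [folklore] -/
theorem mainTerm_hsd (c d : Fin m → σ → ℂ) (b₀ : ℕ) (j : Fin m ⊕ Fin m) (k : ℕ) (hk : k ≤ b₀) :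
    HSD (Fin (b₀ + 1) × Fin (b₀ + 1)) (mainTerm I c d b₀ j k) := by
  have h1 := hsd_binChar (σ := σ) (tab c d j I.b) k b₀ hk I.b
  have h2 := h1.mulHom (restProd_add I (tab c d j))
  have h3 := h2.mul (hsd_choose I (b₀ - 1 - k) (b₀ - k) b₀ (by omega))
  unfold mainTerm
  exact h3.constMul _

/-- The slice index set (`|SIdx m b| = 2 m (b + 1)^3 + 1`). [folklore] -/
abbrev SIdx (m b₀ : ℕ) := ((Fin m ⊕ Fin m) × (Fin (b₀ + 1) × (Fin (b₀ + 1) × Fin (b₀ + 1)))) ⊕ Unit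

omit [Fintype σ] [DecidableEq σ] in
theorem card_SIdx (m b₀ : ℕ) : Fintype.card (SIdx m b₀) = 2 * m * (b₀ + 1) ^ 3 + 1 := by
  simp only [SIdx, Fintype.card_sum, Fintype.card_prod, Fintype.card_fin, Fintype.card_unit]
  ring

/-- **Finite shift rank of the slice functions.** [folklore] -/
theorem Fsl_hsd (c d : Fin m → σ → ℂ) (b₀ : ℕ) : HSD (SIdx m b₀) (Fsl I c d b₀) := by
  have hmain : HSD ((Fin m ⊕ Fin m) × (Fin (b₀ + 1) × (Fin (b₀ + 1) × Fin (b₀ + 1))))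
      (fun ν => ∑ j : Fin m ⊕ Fin m, ∑ k : Fin (b₀ + 1), mainTerm I c d b₀ j k ν) :=
    HSD.sum _ fun j => HSD.sum (fun (k : Fin (b₀ + 1)) ν => mainTerm I c d b₀ j k ν)
      fun k => mainTerm_hsd I c d b₀ j k (Nat.lt_succ_iff.mp k.isLt)
  have h := (HSD.homMul (ind_add I) hmain).add (corr_hsd I c d b₀)
  unfold Fsl
  exact h

/-- The shift decomposition, unpacked. [folklore] -/
theorem Fsl_shift (c d : Fin m → σ → ℂ) (b₀ : ℕ) :
    ∃ (col : (σ → ℕ) → SIdx m b₀ → ℂ) (ch : SIdx m b₀ → (σ → ℕ) → ℂ),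
      ∀ β w : σ → ℕ, Fsl I c d b₀ (β + w) = ∑ i, col β i * ch i w :=
  Fsl_hsd I c d b₀

end ShiftDecomp

/-! ## Part T6: Lemma A upstairs for a toric lift (verbatim copy of the R6 module's `LemmaA` section) -/

section LemmaA
variable {τ : Type*} [Fintype τ] [DecidableEq τ] (M : σ → (τ →₀ ℕ)) {m : ℕ}

omit [DecidableEq σ] in
theorem coeff_zero_phiT_lin (hM : ∀ i, M i ≠ 0) (a : σ → ℂ) : coeff 0 (phiT M (lin a)) = 0 := by
  classical
  unfold lin
  rw [map_sum, coeff_sum]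
  refine Finset.sum_eq_zero fun i _ => ?_
  rw [map_smul, phiT_X, coeff_smul, coeff_monomial, if_neg (hM i), smul_zero]

omit [DecidableEq σ] in
theorem coeff_zero_one_add_phiT_lin (hM : ∀ i, M i ≠ 0) (a : σ → ℂ) : coeff 0 (1 + phiT M (lin a)) = 1 := by
  rw [coeff_add, coeff_zero_phiT_lin M hM, add_zero, coeff_zero_one]

omit [DecidableEq σ] [Fintype τ] [DecidableEq τ] in
theorem phiT_liftG (c d : Fin m → σ → ℂ) :
    phiT M (liftG c d) = ∏ j, (1 + phiT M (lin (c j))) - ∏ j, (1 + phiT M (lin (d j))) := by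
  unfold liftG
  simp only [map_sub, map_prod, map_add, map_one]

omit [DecidableEq σ] [Fintype τ] [DecidableEq τ] in
theorem phiT_logTrunc (c d : Fin m → σ → ℂ) (R : ℕ) :
    phiT M (logTrunc c d R) = ∑ r ∈ Finset.Icc 1 R, ((-1 : ℂ) ^ (r + 1) / (r : ℂ)) •
      (∑ j, ((1 + phiT M (lin (c j))) - 1) ^ r - ∑ j, ((1 + phiT M (lin (d j))) - 1) ^ r) := by
  unfold logTrunc
  simp only [map_sum, map_smul, map_sub, map_pow, map_add, map_one]

/-- **Lemma A for a toric lift.** If `x₀` is a strict `θ`-minimum (`θ ≥ 1`) of the support of `φ_M(G)`, then it is a strict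
`θ`-minimum of the support of `φ_M(Λ_R)`, `R = ⌊θ(x₀)⌋ + 1`. [folklore] -/
theorem toric_minLog (hM : ∀ i, M i ≠ 0) (θ : τ → ℝ) (hθ : ∀ i, 1 ≤ θ i) (c d : Fin m → σ → ℂ) (x₀ : τ →₀ ℕ)
    (h : x₀ ∈ (phiT M (liftG c d)).support ∧ ∀ x ∈ (phiT M (liftG c d)).support, x ≠ x₀ → lwt θ x₀ < lwt θ x) :
    x₀ ∈ (phiT M (logTrunc c d (⌊lwt θ x₀⌋₊ + 1))).support ∧
      ∀ x ∈ (phiT M (logTrunc c d (⌊lwt θ x₀⌋₊ + 1))).support, x ≠ x₀ → lwt θ x₀ < lwt θ x := by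
  have hadd := lwt_add θ
  have hpos := one_le_lwt_of_ne_zero θ hθ
  set R : ℕ := ⌊lwt θ x₀⌋₊ + 1 with hRdef
  have hR : lwt θ x₀ < (R : ℝ) := by
    rw [hRdef]; push_cast; exact Nat.lt_floor_add_one _
  have hu : ∀ j, coeff 0 (1 + phiT M (lin (c j))) = 1 := fun j => coeff_zero_one_add_phiT_lin M hM (c j)
  have hv : ∀ j, coeff 0 (1 + phiT M (lin (d j))) = 1 := fun j => coeff_zero_one_add_phiT_lin M hM (d j)
  have key := strictMin_sub_iff_of_congr (lwt θ) hadd hpos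
    (MvPolynomial.mkDerivation ℂ fun i : τ => ((θ i : ℝ) : ℂ) • (X i : MvPolynomial τ ℂ))
    (coeff_eulerDerivation θ) (∏ j, (1 + phiT M (lin (c j)))) (∏ j, (1 + phiT M (lin (d j)))) _
    (coeff_zero_prod_eq_one _ hu) (coeff_zero_prod_eq_one _ hv) (coeff_zero_logTrunc _ _ hu hv R) R
    (coeff_wronskian_congr _ hadd hpos _ _ _ hu hv R) x₀ hR
  rw [← phiT_liftG, ← phiT_logTrunc] at key
  exact key.mp h

end LemmaA

/-! ## Part T7: the planar instance — three-term relation data `α = β + γ`, the free lift of the chain, injectivity of the letter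
push-forward on the lifted support from rank-one coincidences, lifted visible points, letter weights -/

section FreePlanar
open Summit.ValiantsHypothesis.ValiantsHypothesis.Theorems.NewtonUnitEquations.TwoProducts.FormalLogLinearisation
open Summit.ValiantsHypothesis.ValiantsHypothesis.Theorems.NewtonUnitEquations.TwoProducts.PlanarCell

variable {m : ℕ}

/-- **Rank-one coincidences** of a letter family (verbatim the R6 module's `RankOneCoincidences`): every additive coincidence of
two tuples is, at the level of letter multisets, a multiple of the one relation `ρ⁺ ~ ρ⁻`. [folklore] -/
def RankOneCoincidences (A : Fin m → Finset Expo) (ρp ρm : Expo →₀ ℕ) : Prop :=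
  ∀ a ∈ tuples A, ∀ b ∈ tuples A, ∑ j, a j = ∑ j, b j →
    ∃ k : ℕ, msetT a + k • ρp = msetT b + k • ρm ∨ msetT b + k • ρp = msetT a + k • ρm

omit [Fintype σ] [DecidableEq σ] in
/-- Permutation type is the case `k = 0`. [folklore] -/
theorem rankOneCoincidences_of_permType (A : Fin m → Finset Expo) (h : PermType A) (ρp ρm : Expo →₀ ℕ) :
    RankOneCoincidences A ρp ρm := fun a ha b hb hab => ⟨0, Or.inl (by simpa using h a ha b hb hab)⟩

omit [Fintype σ] [DecidableEq σ] in
/-- Letters of a tuple lie in the family. [folklore] -/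
theorem msetT_apply_eq_zero (A : Fin m → Finset Expo) (a : Fin m → Expo) (ha : a ∈ tuples A) (e : Expo)
    (he : ∀ j, e ∉ A j) : msetT a e = 0 := by
  classical
  unfold msetT
  rw [Finsupp.finset_sum_apply]
  refine Finset.sum_eq_zero fun j _ => ?_
  by_cases h0 : a j = 0
  · rw [if_pos h0]; rfl
  · rw [if_neg h0, Finsupp.single_apply, if_neg]
    intro hje
    have hmem := Fintype.mem_piFinset.1 ha j
    rw [Finset.mem_insert] at hmem
    rcases hmem with h | h
    · exact h0 h
    · exact he j (hje ▸ h)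

omit [Fintype σ] [DecidableEq σ] in
/-- **Degenerate relations.** If one of the three relation letters is absent from the family, rank-one coincidences for the
three-term relation are already of permutation type. [folklore] -/
theorem permType_of_absent_letter (A : Fin m → Finset Expo) (α β γ : Expo) (hab : α ≠ β) (hac : α ≠ γ) (hbc : β ≠ γ)
    (hR : RankOneCoincidences A (Finsupp.single β 1 + Finsupp.single γ 1) (Finsupp.single α 1))
    (e : Expo) (he : e = α ∨ e = β ∨ e = γ) (hnot : ∀ j, e ∉ A j) : PermType A := by
  intro a ha b hb hab'
  obtain ⟨k, hk⟩ := hR a ha b hb hab'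
  have ha0 := msetT_apply_eq_zero A a ha e hnot
  have hb0 := msetT_apply_eq_zero A b hb e hnot
  have hk0 : k = 0 := by
    rcases hk with hk | hk <;>
    · have h1 := DFunLike.congr_fun hk e
      simp only [Finsupp.add_apply, Finsupp.smul_apply, smul_eq_mul, Finsupp.single_apply, ha0, hb0] at h1
      rcases he with rfl | rfl | rfl <;>
        simp [hab, hac, hbc, hab.symm, hac.symm, hbc.symm] at h1 <;> omega
  subst hk0
  simp only [zero_smul, add_zero] at hk
  rcases hk with hk | hk
  · exact hk
  · exact hk.symm

variable (u v : Fin m → MvPolynomial (Fin 2) ℂ)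

/-- The index of a tail letter. [folklore] -/
def idxOf (e : Expo) (he : e ∈ tailSupport u v) : Fin (sE u v) := (tailSupport u v).equivFin ⟨e, he⟩

omit [Fintype σ] [DecidableEq σ] in
theorem enum_idxOf (e : Expo) (he : e ∈ tailSupport u v) : enum u v (idxOf u v e he) = e := by
  unfold enum idxOf
  rw [Equiv.symm_apply_apply]

/-- **Planar three-term relation data**: distinct tail letters `α, β, γ` with `α = β + γ`. [folklore] -/
structure RelData where
  /-- the letter `α` -/
  α : Expo
  /-- the letter `β` -/
  β : Expo
  /-- the letter `γ` -/
  γ : Expo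
  hα : α ∈ tailSupport u v
  hβ : β ∈ tailSupport u v
  hγ : γ ∈ tailSupport u v
  hab : α ≠ β
  hac : α ≠ γ
  hbc : β ≠ γ
  hrel : α = β + γ

variable {u v}
variable (D : RelData u v)

/-- The three indices of the relation letters. [folklore] -/
def RelData.idx : ThreeIdx (Fin (sE u v)) where
  a := idxOf u v D.α D.hα
  b := idxOf u v D.β D.hβ
  c := idxOf u v D.γ D.hγ
  hab h := D.hab (by have := congrArg (enum u v) h; rwa [enum_idxOf, enum_idxOf] at this)
  hac h := D.hac (by have := congrArg (enum u v) h; rwa [enum_idxOf, enum_idxOf] at this)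
  hbc h := D.hbc (by have := congrArg (enum u v) h; rwa [enum_idxOf, enum_idxOf] at this)

omit [Fintype σ] [DecidableEq σ] in
theorem RelData.enum_a : enum u v D.idx.a = D.α := enum_idxOf u v _ _
omit [Fintype σ] [DecidableEq σ] in
theorem RelData.enum_b : enum u v D.idx.b = D.β := enum_idxOf u v _ _
omit [Fintype σ] [DecidableEq σ] in
theorem RelData.enum_c : enum u v D.idx.c = D.γ := enum_idxOf u v _ _

omit [Fintype σ] [DecidableEq σ] in
/-- The letter push-forward is invariant under the free substitution: `π_enum (frM i) = enum i`. [folklore] -/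
theorem RelData.piE_enum_frM (i : Fin (sE u v)) : piE (enum u v) (frM D.idx i) = enum u v i := by
  by_cases hia : i = D.idx.a
  · subst hia
    rw [frM_a, piE_eq_piT, piT_add, piT_single, piT_single, one_smul, one_smul, D.enum_b, D.enum_c, D.enum_a, D.hrel]
  · rw [frM_other D.idx i hia, piE_eq_piT, piT_single, one_smul]

omit [Fintype σ] [DecidableEq σ] in
/-- On exponents: letter push-forward ∘ free substitution = letter push-forward. [folklore] -/
theorem RelData.piE_enum_piT (L : Fin (sE u v) →₀ ℕ) : piE (enum u v) (piT (frM D.idx) L) = piE (enum u v) L := by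
  have hM : (fun i => piT (enum u v) (frM D.idx i)) = enum u v := by
    funext i
    rw [← piE_eq_piT]
    exact D.piE_enum_frM i
  rw [piE_eq_piT, piE_eq_piT, piT_piT, hM]

omit [Fintype σ] [DecidableEq σ] in
/-- On polynomials: letter push-forward ∘ free substitution = letter push-forward. [folklore] -/
theorem RelData.phi_enum_phiT (H : MvPolynomial (Fin (sE u v)) ℂ) :
    phi (enum u v) (phiT (frM D.idx) H) = phi (enum u v) H := by
  have hM : (fun i => piT (enum u v) (frM D.idx i)) = enum u v := by
    funext i
    rw [← piE_eq_piT]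
    exact D.piE_enum_frM i
  rw [phi_eq_phiT, phiT_phiT, hM]

/-- The free lift of the chain difference. [folklore] -/
def RelData.GT : MvPolynomial (Fin (sE u v)) ℂ := phiT (frM D.idx) (liftG (cU u v) (cV u v))

omit [Fintype σ] [DecidableEq σ] in
/-- Its letter push-forward is the planar difference of products. [folklore] -/
theorem RelData.phi_GT : phi (enum u v) D.GT = tailDiff u v := by
  unfold RelData.GT
  rw [D.phi_enum_phiT, phi_liftG]

omit [Fintype σ] [DecidableEq σ] in
theorem RelData.exists_of_mem_support_GT (x : Fin (sE u v) →₀ ℕ) (hx : x ∈ D.GT.support) :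
    ∃ L ∈ (liftG (cU u v) (cV u v)).support, piT (frM D.idx) L = x :=
  exists_of_mem_support_phiT (frM D.idx) _ x hx

omit [Fintype σ] [DecidableEq σ] in
theorem RelData.apply_a_of_mem_support_GT (x : Fin (sE u v) →₀ ℕ) (hx : x ∈ D.GT.support) : x D.idx.a = 0 := by
  obtain ⟨L, -, rfl⟩ := D.exists_of_mem_support_GT x hx
  exact piT_frM_a D.idx L

omit [Fintype σ] [DecidableEq σ] in
/-- **Injectivity from rank-one coincidences** (shape `α = β + γ`). [folklore] -/
theorem RelData.injOn_of_rankOne (hu : ∀ j, coeff 0 (u j) = 0) (hv : ∀ j, coeff 0 (v j) = 0)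
    (hR : RankOneCoincidences (fun j => (u j).support ∪ (v j).support)
      (Finsupp.single D.β 1 + Finsupp.single D.γ 1) (Finsupp.single D.α 1)) :
    Set.InjOn (piE (enum u v)) ↑D.GT.support := by
  classical
  set A : Fin m → Finset Expo := fun j => (u j).support ∪ (v j).support with hA
  have hcU : ∀ j i, cU u v j i ≠ 0 → enum u v i ∈ A j := fun j i h =>
    Finset.mem_union_left _ (mem_support_iff.mpr h)
  have hcV : ∀ j i, cV u v j i ≠ 0 → enum u v i ∈ A j := fun j i h =>
    Finset.mem_union_right _ (mem_support_iff.mpr h)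
  have key : ∀ κ ∈ (liftG (cU u v) (cV u v)).support,
      ∃ a ∈ tuples A, ∑ j, a j = piE (enum u v) κ ∧ msetT a = Finsupp.mapDomain (enum u v) κ := by
    intro κ hκ
    unfold liftG at hκ
    rcases Finset.mem_union.1 (support_sub _ _ _ hκ) with h | h
    · exact tuple_of_mem_support_prod u v hu hv A (cU u v) hcU κ h
    · exact tuple_of_mem_support_prod u v hu hv A (cV u v) hcV κ h
  set ρp : Fin (sE u v) →₀ ℕ := Finsupp.single D.idx.b 1 + Finsupp.single D.idx.c 1 with hρp
  set ρm : Fin (sE u v) →₀ ℕ := Finsupp.single D.idx.a 1 with hρm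
  have hmp : Finsupp.mapDomain (enum u v) ρp = Finsupp.single D.β 1 + Finsupp.single D.γ 1 := by
    rw [hρp, Finsupp.mapDomain_add, Finsupp.mapDomain_single, Finsupp.mapDomain_single, D.enum_b, D.enum_c]
  have hmm : Finsupp.mapDomain (enum u v) ρm = Finsupp.single D.α 1 := by
    rw [hρm, Finsupp.mapDomain_single, D.enum_a]
  have hπρ : piT (frM D.idx) ρp = piT (frM D.idx) ρm := by
    rw [hρp, hρm, piT_add, piT_single, piT_single, piT_single, one_smul, one_smul, one_smul,
      frM_other D.idx D.idx.b D.idx.hab.symm, frM_other D.idx D.idx.c D.idx.hac.symm, frM_a]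
  have hmapk : ∀ (k : ℕ) (L ρ : Fin (sE u v) →₀ ℕ),
      Finsupp.mapDomain (enum u v) (L + k • ρ) = Finsupp.mapDomain (enum u v) L + k • Finsupp.mapDomain (enum u v) ρ := by
    intro k L ρ
    rw [Finsupp.mapDomain_add]
    congr 1
    exact map_nsmul (Finsupp.mapDomain.addMonoidHom (enum u v)) k ρ
  have cancel : ∀ (k : ℕ) (L L' : Fin (sE u v) →₀ ℕ), L + k • ρp = L' + k • ρm →
      piT (frM D.idx) L = piT (frM D.idx) L' := by
    intro k L L' h
    have := congrArg (piT (frM D.idx)) h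
    rw [piT_add, piT_add, piT_nsmul, piT_nsmul, hπρ] at this
    exact add_right_cancel this
  intro x hx x' hx' hπ
  obtain ⟨L, hL, rfl⟩ := D.exists_of_mem_support_GT x hx
  obtain ⟨L', hL', rfl⟩ := D.exists_of_mem_support_GT x' hx'
  rw [D.piE_enum_piT, D.piE_enum_piT] at hπ
  obtain ⟨a, ha, haS, haM⟩ := key L hL
  obtain ⟨b, hb, hbS, hbM⟩ := key L' hL'
  obtain ⟨k, hk⟩ := hR a ha b hb (by rw [haS, hbS]; exact hπ)
  rw [haM, hbM, ← hmp, ← hmm, ← hmapk, ← hmapk, ← hmapk, ← hmapk] at hk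
  rcases hk with hk | hk
  · exact cancel k L L' (Finsupp.mapDomain_injective (enum_injective u v) hk)
  · exact (cancel k L' L (Finsupp.mapDomain_injective (enum_injective u v) hk)).symm

omit [Fintype σ] [DecidableEq σ] in
/-- Visible points lift to strict `ξ`-maxima of the freely lifted support (under injectivity). [folklore] -/
theorem RelData.lifted_of_visible (hinj : Set.InjOn (piE (enum u v)) ↑D.GT.support) (ξ : Fin 2 → ℝ) (l : Expo)
    (htop : IsStrictTop ξ ↑(tailDiff u v).support l) :
    ∃ x₀ : Fin (sE u v) →₀ ℕ, x₀ ∈ D.GT.support ∧ piE (enum u v) x₀ = l ∧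
      ∀ x ∈ D.GT.support, x ≠ x₀ → wt ξ (piE (enum u v) x) < wt ξ l := by
  have hsupp : tailDiff u v = phi (enum u v) D.GT := D.phi_GT.symm
  obtain ⟨hl, hlt⟩ := htop
  have hl' : l ∈ (phi (enum u v) D.GT).support := by rw [← hsupp]; exact hl
  obtain ⟨x₀, hx₀, hπ⟩ := exists_of_mem_support_phi (enum u v) _ l hl'
  refine ⟨x₀, hx₀, hπ, fun x hx hne => ?_⟩
  have hcoeff : coeff (piE (enum u v) x) (tailDiff u v) ≠ 0 := by
    rw [hsupp, coeff_phi_of_injOn (enum u v) _ hinj x hx]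
    exact mem_support_iff.mp hx
  have hneπ : piE (enum u v) x ≠ l := fun h => hne (hinj hx hx₀ (h.trans hπ.symm))
  exact hlt _ (mem_support_iff.mpr hcoeff) hneπ

/-! ### The upstairs weights: the letter weights themselves -/

/-- Letter weights `r_i = -wt ξ (enum i) > 0`. [folklore] -/
def rW (ξ : Fin 2 → ℝ) (i : Fin (sE u v)) : ℝ := -wt ξ (enum u v i)

omit [Fintype σ] [DecidableEq σ] in
theorem rW_pos (ξ : Fin 2 → ℝ) (hval : ValidWeight u v ξ) (i : Fin (sE u v)) : 0 < rW (u := u) (v := v) ξ i := by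
  unfold rW; linarith [wt_enum_neg u v ξ hval i]

omit [DecidableEq σ] in
/-- Linear weights of a single letter. [folklore] -/
theorem lwt_single (θ : σ → ℝ) (i : σ) : lwt θ (Finsupp.single i 1) = θ i := by
  classical
  unfold lwt
  simp [Finsupp.single_apply]

omit [DecidableEq σ] in
/-- Linear weights commute with monomial substitutions. [folklore] -/
theorem lwt_piT {τ : Type*} [Fintype τ] (θ : τ → ℝ) (M : σ → (τ →₀ ℕ)) (L : σ →₀ ℕ) :
    lwt θ (piT M L) = lwt (fun i => lwt θ (M i)) L := by
  unfold lwt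
  simp only [piT_apply]
  push_cast
  simp only [Finset.mul_sum, Finset.sum_mul]
  rw [Finset.sum_comm]
  refine Finset.sum_congr rfl fun i _ => Finset.sum_congr rfl fun j _ => by ring

omit [Fintype σ] [DecidableEq σ] in
/-- The relation among letter weights: `r_a = r_b + r_c`. [folklore] -/
theorem RelData.rW_rel (ξ : Fin 2 → ℝ) : rW ξ D.idx.a = rW ξ D.idx.b + rW (u := u) (v := v) ξ D.idx.c := by
  unfold rW
  rw [D.enum_a, D.enum_b, D.enum_c, D.hrel, wt_add]; ring

omit [Fintype σ] [DecidableEq σ] in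
/-- The letter weight of a substituted letter is its planar weight. [folklore] -/
theorem RelData.lwt_rW_frM (ξ : Fin 2 → ℝ) (i : Fin (sE u v)) : lwt (rW ξ) (frM D.idx i) = rW (u := u) (v := v) ξ i := by
  by_cases hia : i = D.idx.a
  · subst hia; rw [frM_a, lwt_add, lwt_single, lwt_single, D.rW_rel]
  · rw [frM_other D.idx i hia, lwt_single]

omit [Fintype σ] [DecidableEq σ] in
/-- On toric images the letter weight is the planar weight of the push-forward. [folklore] -/
theorem RelData.lwt_rW_piT (ξ : Fin 2 → ℝ) (L : Fin (sE u v) →₀ ℕ) :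
    lwt (rW ξ) (piT (frM D.idx) L) = -wt ξ (piE (enum u v) (piT (frM D.idx) L)) := by
  rw [lwt_piT, D.piE_enum_piT, ← lwt_eq_neg_wt]
  congr 1
  funext i
  exact D.lwt_rW_frM ξ i

/-- Splitting a linear weight along the slice: `θ(x) = Σ_i θ_i x̂_i + θ_c x_c` for `x_a = 0`. [folklore] -/
theorem lwt_split (I : ThreeIdx σ) (θ : σ → ℝ) (x : σ →₀ ℕ) (hx : x I.a = 0) :
    lwt θ x = (∑ i, θ i * ((xhat I x i : ℕ) : ℝ)) + θ I.c * ((x I.c : ℕ) : ℝ) := by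
  unfold lwt
  rw [sum_three_split I, sum_three_split I (fun i => θ i * ((xhat I x i : ℕ) : ℝ)), xhat_a, xhat_b, xhat_c, hx]
  have hr : ∑ i ∈ rest I, θ i * ((x i : ℕ) : ℝ) = ∑ i ∈ rest I, θ i * ((xhat I x i : ℕ) : ℝ) := by
    refine Finset.sum_congr rfl fun j hj => ?_
    rw [mem_rest] at hj
    rw [xhat_other I x j hj.1 hj.2.2]
  rw [hr]
  push_cast
  ring

end FreePlanar

/-! ## Part T8: per visible point a zero-avoiding strict pencil-minimiser of a slice function; the fibrewise count via
val-lit-p3's `ShiftRank.pencilCount`; the arithmetic; the law -/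

section FreeCount
open Summit.ValiantsHypothesis.ValiantsHypothesis.Theorems.NewtonUnitEquations.TwoProducts.FormalLogLinearisation
open Summit.ValiantsHypothesis.ValiantsHypothesis.Theorems.NewtonUnitEquations.TwoProducts.PlanarCell

variable {m : ℕ} {u v : Fin m → MvPolynomial (Fin 2) ℂ} (D : RelData u v)

omit [Fintype σ] [DecidableEq σ] in
/-- **Per visible point.** A visible point `l` (valid `ξ`) yields a toric point `x₀` over it (`x₀(a) = 0`) with slice coordinate
`b = x₀(c) ≤ m`, whose reduced exponent `x̂₀` is a zero-avoiding STRICT minimiser of the letter-weight functional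
`ν ↦ Σ_i r_i ν_i` on `{ν : F_b(ν) ≠ 0}` over ALL of `ℕ^s`. [folklore] -/
theorem RelData.sliceMin_of_visible (hu : ∀ j, coeff 0 (u j) = 0) (hv : ∀ j, coeff 0 (v j) = 0)
    (hinj : Set.InjOn (piE (enum u v)) ↑D.GT.support) (ξ : Fin 2 → ℝ) (hval : ValidWeight u v ξ) (l : Expo)
    (htop : IsStrictTop ξ ↑(tailDiff u v).support l) :
    ∃ x₀ : Fin (sE u v) →₀ ℕ, piE (enum u v) x₀ = l ∧ x₀ D.idx.a = 0 ∧ x₀ D.idx.c ≤ m ∧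
      Fsl D.idx (cU u v) (cV u v) (x₀ D.idx.c) (xhat D.idx x₀) ≠ 0 ∧
      ∀ ν : Fin (sE u v) → ℕ, ν ≠ ⇑(xhat D.idx x₀) → Fsl D.idx (cU u v) (cV u v) (x₀ D.idx.c) ν ≠ 0 →
        ∑ i, rW ξ i * ((xhat D.idx x₀ i : ℕ) : ℝ) < ∑ i, rW (u := u) (v := v) ξ i * (ν i : ℝ) := by
  classical
  have _hu := hu; have _hv := hv
  obtain ⟨x₀, hx₀, hπ, hmin⟩ := D.lifted_of_visible hinj ξ l htop
  obtain ⟨L₀, hL₀, hx₀L⟩ := D.exists_of_mem_support_GT x₀ hx₀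
  have hx₀a : x₀ D.idx.a = 0 := D.apply_a_of_mem_support_GT x₀ hx₀
  have hdegL : deg L₀ ≤ m := deg_le_of_mem_support_liftG _ _ L₀ hL₀
  have hc_le : x₀ D.idx.c ≤ m := by
    rw [← hx₀L, piT_frM_c]
    have h := deg_eq_sum L₀
    rw [sum_three_split D.idx] at h
    omega
  -- the upstairs weights and their normalisation
  set θ : Fin (sE u v) → ℝ := rW ξ with hθdef
  have hθpos : ∀ i, 0 < θ i := rW_pos ξ hval
  have hne : (Finset.univ : Finset (Fin (sE u v))).Nonempty := ⟨D.idx.a, Finset.mem_univ _⟩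
  set θmin : ℝ := Finset.univ.inf' hne θ with hθmin
  have hθmin_pos : 0 < θmin := by
    obtain ⟨i, -, hi⟩ := Finset.exists_mem_eq_inf' hne θ
    rw [hθmin, hi]; exact hθpos i
  have hθmin_le : ∀ i, θmin ≤ θ i := fun i => Finset.inf'_le θ (Finset.mem_univ i)
  set θ' : Fin (sE u v) → ℝ := fun i => θ i / θmin with hθ'
  have hθ'1 : ∀ i, 1 ≤ θ' i := fun i => by
    rw [hθ']; simp only; rw [le_div_iff₀ hθmin_pos, one_mul]; exact hθmin_le i
  have hlwt' : ∀ x : Fin (sE u v) →₀ ℕ, lwt θ' x = lwt θ x / θmin := fun x => by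
    unfold lwt; rw [Finset.sum_div]
    refine Finset.sum_congr rfl fun i _ => ?_
    rw [hθ']; ring
  have hlwtG : ∀ x ∈ D.GT.support, lwt θ x = -wt ξ (piE (enum u v) x) := fun x hx => by
    obtain ⟨L, -, rfl⟩ := D.exists_of_mem_support_GT x hx
    exact D.lwt_rW_piT ξ L
  have hminθ' : x₀ ∈ (phiT (frM D.idx) (liftG (cU u v) (cV u v))).support ∧
      ∀ x ∈ (phiT (frM D.idx) (liftG (cU u v) (cV u v))).support, x ≠ x₀ → lwt θ' x₀ < lwt θ' x := by
    refine ⟨hx₀, fun x hx hne' => ?_⟩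
    rw [hlwt', hlwt']
    apply div_lt_div_of_pos_right _ hθmin_pos
    rw [hlwtG x₀ hx₀, hlwtG x hx, hπ]
    linarith [hmin x hx hne']
  have hA := toric_minLog (frM D.idx) (frM_ne_zero D.idx) θ' hθ'1 (cU u v) (cV u v) x₀ hminθ'
  set R : ℕ := ⌊lwt θ' x₀⌋₊ + 1 with hRdef
  have hRlt : lwt θ' x₀ < R := by rw [hRdef]; push_cast; exact Nat.lt_floor_add_one _
  -- `x₀ ≠ 0` and `deg x₀ ≤ R`
  have hx₀ne : x₀ ≠ 0 := by
    intro h0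
    have := mem_support_iff.mp hx₀
    apply this
    rw [h0]
    unfold RelData.GT
    rw [phiT_liftG, coeff_sub,
      coeff_zero_prod_eq_one _ (fun j => coeff_zero_one_add_phiT_lin (frM D.idx) (frM_ne_zero D.idx) _),
      coeff_zero_prod_eq_one _ (fun j => coeff_zero_one_add_phiT_lin (frM D.idx) (frM_ne_zero D.idx) _), sub_self]
  have hdegR : deg x₀ ≤ R := by
    have h2 : (deg x₀ : ℝ) ≤ lwt θ' x₀ := deg_le_lwt θ' hθ'1 x₀
    have h3 : (deg x₀ : ℝ) < R := lt_of_le_of_lt h2 hRlt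
    have h4 : deg x₀ < R := by exact_mod_cast h3
    omega
  have hF0 : Fsl D.idx (cU u v) (cV u v) (x₀ D.idx.c) (xhat D.idx x₀) ≠ 0 :=
    (mem_support_free_logTrunc_iff D.idx (cU u v) (cV u v) R x₀ hx₀a hx₀ne hdegR).mp hA.1
  refine ⟨x₀, hπ, hx₀a, hc_le, hF0, fun ν hν hFν => ?_⟩
  obtain ⟨hνa, hνc⟩ := shape_of_Fsl_ne_zero D.idx (cU u v) (cV u v) _ ν hFν
  set x' : Fin (sE u v) →₀ ℕ := xOf D.idx (x₀ D.idx.c) ν with hx'def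
  have hx'a : x' D.idx.a = 0 := xOf_a D.idx _ ν
  have hxh' : ⇑(xhat D.idx x') = ν := xhat_xOf D.idx _ ν hνa hνc
  have hx'c : x' D.idx.c = x₀ D.idx.c := xOf_c D.idx _ ν
  have hne' : x' ≠ x₀ := by
    intro h; apply hν; rw [← hxh', h]
  have hx'ne : x' ≠ 0 := by
    intro hz
    have hνz : ∀ j, ν j = 0 := fun j => by rw [← hxh', hz]; simp [xhat]
    have hb0 : x₀ D.idx.c = 0 := by rw [← hx'c, hz]; rfl
    apply hFν
    rw [hb0]; exact Fsl_zero_zero D.idx (cU u v) (cV u v) ν hνz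
  have hlt' : lwt θ' x₀ < lwt θ' x' := by
    by_cases hR' : deg x' ≤ R
    · have hmem : x' ∈ (phiT (frM D.idx) (logTrunc (cU u v) (cV u v) R)).support :=
        (mem_support_free_logTrunc_iff D.idx (cU u v) (cV u v) R x' hx'a hx'ne hR').mpr
          (by rw [hx'c, hxh']; exact hFν)
      exact hA.2 x' hmem hne'
    · push Not at hR'
      have h2 : (deg x' : ℝ) ≤ lwt θ' x' := deg_le_lwt θ' hθ'1 x'
      have h3 : (R : ℝ) < deg x' := by exact_mod_cast hR'
      linarith
  have hlt : lwt θ x₀ < lwt θ x' := by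
    have := hlt'
    rw [hlwt', hlwt'] at this
    exact (div_lt_div_iff_of_pos_right hθmin_pos).mp this
  rw [lwt_split D.idx θ x₀ hx₀a, lwt_split D.idx θ x' hx'a, hx'c] at hlt
  rw [hxh'] at hlt
  linarith

/-- The uniform width surrogate `N_m = 2 m (m+1)^3 + 1 ≥ |SIdx m b|` (`b ≤ m`). [folklore] -/
def Nm (m : ℕ) : ℕ := 2 * m * (m + 1) ^ 3 + 1

/-- The slice bound, uniform in `b ≤ m`. [folklore] -/
def sliceBd (m s : ℕ) : ℕ := (s + 2) ^ 3 * (Nm m + 2) ^ (3 * (Nat.log 2 (Nm m + 2) + 1))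

omit [DecidableEq σ] in
/-- Monotonicity of the tool-shaped bound in the width. [folklore] -/
theorem toolBound_mono (s A : ℕ) {N N' : ℕ} (h : N ≤ N') :
    (s + 2) ^ A * (N + 2) ^ (A * (Nat.log 2 (N + 2) + 1)) ≤ (s + 2) ^ A * (N' + 2) ^ (A * (Nat.log 2 (N' + 2) + 1)) := by
  refine Nat.mul_le_mul_left _ ?_
  calc (N + 2) ^ (A * (Nat.log 2 (N + 2) + 1)) ≤ (N' + 2) ^ (A * (Nat.log 2 (N + 2) + 1)) :=
        Nat.pow_le_pow_left (by omega) _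
    _ ≤ (N' + 2) ^ (A * (Nat.log 2 (N' + 2) + 1)) :=
        Nat.pow_le_pow_right (by omega) (Nat.mul_le_mul_left _ (by
          have := Nat.log_mono_right (b := 2) (show N + 2 ≤ N' + 2 by omega); omega))

omit [Fintype σ] [DecidableEq σ] in
/-- **The per-slice count** from finite shift rank (val-lit-p3's `ShiftRank.pencilCount`, BY NAME). [folklore] -/
theorem sliceCount (b : ℕ) (hbm : b ≤ m) (U V : Fin (sE u v) → ℝ) (Sb : Finset (Fin (sE u v) → ℕ))
    (hhyp : ∀ μ ∈ Sb, Fsl D.idx (cU u v) (cV u v) b μ ≠ 0 ∧ ∃ t : ℝ, ∀ ν : Fin (sE u v) → ℕ, ν ≠ μ →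
      Fsl D.idx (cU u v) (cV u v) b ν ≠ 0 → ∑ i, (U i + t * V i) * (μ i : ℝ) < ∑ i, (U i + t * V i) * (ν i : ℝ)) :
    Sb.card ≤ sliceBd m (sE u v) := by
  obtain ⟨col, ch, hF⟩ := Fsl_shift D.idx (cU u v) (cV u v) b
  have h1 := ShiftRank.pencilCount hF U V Sb hhyp
  rw [card_SIdx] at h1
  have h2 := BinExpSum.pencilCount_arith (sE u v) (2 * m * (b + 1) ^ 3 + 1)
  have h3 : 2 * m * (b + 1) ^ 3 + 1 ≤ Nm m :=
    Nat.add_le_add_right (Nat.mul_le_mul_left _ (Nat.pow_le_pow_left (by omega) 3)) 1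
  exact h1.trans (h2.trans (toolBound_mono (sE u v) 3 h3))

omit [Fintype σ] [DecidableEq σ] in
/-- **The count for a non-degenerate three-term rank-one relation** (all three letters in the alphabet). [folklore] -/
theorem RelData.count (hu : ∀ j, coeff 0 (u j) = 0) (hv : ∀ j, coeff 0 (v j) = 0)
    (hR : RankOneCoincidences (fun j => (u j).support ∪ (v j).support)
      (Finsupp.single D.β 1 + Finsupp.single D.γ 1) (Finsupp.single D.α 1))
    (S : Finset Expo) (hS : ∀ l ∈ S, ∃ ξ : Fin 2 → ℝ, ValidWeight u v ξ ∧ IsStrictTop ξ ↑(tailDiff u v).support l) :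
    S.card ≤ (m + 1) * sliceBd m (sE u v) := by
  classical
  rcases S.eq_empty_or_nonempty with hSe | hSne
  · simp [hSe]
  obtain ⟨l₀, hl₀⟩ := hSne
  obtain ⟨ξ₀, hval₀, htop₀⟩ := hS l₀ hl₀
  have hTne : (tailSupport u v).Nonempty := tailSupport_nonempty_of_mem u v l₀ htop₀.1
  have hsE : 0 < sE u v := Finset.card_pos.mpr hTne
  set e₀ : Expo := enum u v ⟨0, hsE⟩ with he₀def
  have he₀ : e₀ ≠ 0 := enum_ne_zero u v hu hv _
  obtain ⟨β, τ, hpencil⟩ := pencil_param e₀ he₀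
  have hinj := D.injOn_of_rankOne hu hv hR
  -- choices along `S`
  have hξ : ∀ x : ↥S, ∃ ξ : Fin 2 → ℝ, ValidWeight u v ξ ∧ IsStrictTop ξ ↑(tailDiff u v).support x.1 :=
    fun x => hS x.1 x.2
  choose ξf hξval hξtop using hξ
  have hpt : ∀ x : ↥S, ∃ x₀ : Fin (sE u v) →₀ ℕ, piE (enum u v) x₀ = x.1 ∧ x₀ D.idx.a = 0 ∧ x₀ D.idx.c ≤ m ∧
      Fsl D.idx (cU u v) (cV u v) (x₀ D.idx.c) (xhat D.idx x₀) ≠ 0 ∧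
      ∀ ν : Fin (sE u v) → ℕ, ν ≠ ⇑(xhat D.idx x₀) → Fsl D.idx (cU u v) (cV u v) (x₀ D.idx.c) ν ≠ 0 →
        ∑ i, rW (ξf x) i * ((xhat D.idx x₀ i : ℕ) : ℝ) < ∑ i, rW (u := u) (v := v) (ξf x) i * (ν i : ℝ) :=
    fun x => D.sliceMin_of_visible hu hv hinj (ξf x) (hξval x) x.1 (hξtop x)
  choose xf hxπ hxa hxc hxF hxmin using hpt
  -- normalisation radii and the pencil parameter
  have hrpos : ∀ x : ↥S, 0 < -wt (ξf x) e₀ := fun x => by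
    linarith [wt_enum_neg u v (ξf x) (hξval x) ⟨0, hsE⟩]
  have hnorm : ∀ x : ↥S, wt (fun k => ξf x k / (-wt (ξf x) e₀)) e₀ = -1 := fun x => by
    rw [wt_weight_div]
    have hne : wt (ξf x) e₀ ≠ 0 := by linarith [hrpos x]
    rw [div_neg, div_self hne]
  have hc : ∀ x : ↥S, ∃ c : ℝ, ∀ e : Expo, wt (fun k => ξf x k / (-wt (ξf x) e₀)) e = wt β e + c * wt τ e :=
    fun x => hpencil _ (hnorm x)
  choose cf hcf using hc
  set U : Fin (sE u v) → ℝ := fun i => -wt β (enum u v i) with hU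
  set V : Fin (sE u v) → ℝ := fun i => -wt τ (enum u v i) with hV
  have hUV : ∀ (x : ↥S) (i : Fin (sE u v)),
      U i + cf x * V i = rW (ξf x) i / (-wt (ξf x) e₀) := fun x i => by
    have h := hcf x (enum u v i)
    rw [wt_weight_div] at h
    rw [hU, hV]
    unfold rW
    simp only
    rw [neg_div, h]
    ring
  have hsumUV : ∀ (x : ↥S) (ν : Fin (sE u v) → ℕ), ∑ i, (U i + cf x * V i) * (ν i : ℝ) =
      (∑ i, rW (ξf x) i * (ν i : ℝ)) / (-wt (ξf x) e₀) := fun x ν => by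
    rw [Finset.sum_div]
    refine Finset.sum_congr rfl fun i _ => ?_
    rw [hUV x i]
    ring
  -- the key map `l ↦ (b, x̂₀)` is injective
  set key : ↥S → ℕ × (Fin (sE u v) → ℕ) := fun x => (xf x D.idx.c, ⇑(xhat D.idx (xf x))) with hkey
  have hinjK : Function.Injective key := by
    intro x y h
    rw [hkey] at h
    simp only [Prod.mk.injEq] at h
    have hx : xf x = xf y := by
      rw [← xOf_xhat D.idx (xf x) (hxa x), ← xOf_xhat D.idx (xf y) (hxa y), h.1]
      exact congrArg _ h.2
    apply Subtype.ext
    rw [← hxπ x, ← hxπ y, hx]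
  set Img : Finset (ℕ × (Fin (sE u v) → ℕ)) := (Finset.univ : Finset ↥S).image key with hImg
  have hcard : Img.card = S.card := by
    rw [hImg, Finset.card_image_of_injective _ hinjK, Finset.card_univ, Fintype.card_coe]
  have hfst : ∀ p ∈ Img, p.1 ∈ Finset.range (m + 1) := by
    intro p hp
    obtain ⟨x, -, rfl⟩ := Finset.mem_image.mp hp
    exact Finset.mem_range.mpr (Nat.lt_succ_of_le (hxc x))
  have hfib : ∀ b ∈ Finset.range (m + 1), (Img.filter fun p => p.1 = b).card ≤ sliceBd m (sE u v) := by
    intro b hb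
    have hbm : b ≤ m := Nat.lt_succ_iff.mp (Finset.mem_range.mp hb)
    set Sb : Finset (Fin (sE u v) → ℕ) := (Img.filter fun p => p.1 = b).image Prod.snd with hSb
    have hcardb : (Img.filter fun p => p.1 = b).card = Sb.card := by
      rw [hSb, Finset.card_image_of_injOn]
      intro p hp q hq hpq
      have hp' := (Finset.mem_filter.mp (Finset.mem_coe.mp hp)).2
      have hq' := (Finset.mem_filter.mp (Finset.mem_coe.mp hq)).2
      exact Prod.ext (hp'.trans hq'.symm) hpq
    rw [hcardb]
    refine sliceCount D b hbm U V Sb fun μ hμ => ?_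
    obtain ⟨p, hp, rfl⟩ := Finset.mem_image.mp hμ
    obtain ⟨hpI, hpb⟩ := Finset.mem_filter.mp hp
    obtain ⟨x, -, rfl⟩ := Finset.mem_image.mp hpI
    rw [hkey] at hpb ⊢
    simp only at hpb ⊢
    refine ⟨?_, cf x, fun ν hν hFν => ?_⟩
    · have := hxF x
      rw [hpb] at this
      exact this
    · have hFν' : Fsl D.idx (cU u v) (cV u v) (xf x D.idx.c) ν ≠ 0 := by rw [hpb]; exact hFν
      have hlt := hxmin x ν hν hFν'
      rw [hsumUV x, hsumUV x ν]
      exact div_lt_div_of_pos_right hlt (hrpos x)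
  rw [← hcard, Finset.card_eq_sum_card_fiberwise hfst]
  calc ∑ b ∈ Finset.range (m + 1), (Img.filter fun p => p.1 = b).card
      ≤ ∑ b ∈ Finset.range (m + 1), sliceBd m (sE u v) := Finset.sum_le_sum hfib
    _ = (m + 1) * sliceBd m (sE u v) := by rw [Finset.sum_const, Finset.card_range, smul_eq_mul]

omit [Fintype σ] [DecidableEq σ] in
theorem Nm_add_two_le (m : ℕ) (hm : 1 ≤ m) : Nm m + 2 ≤ 2 * (m + 1) ^ 4 := by
  unfold Nm
  have h3 : 8 ≤ (m + 1) ^ 3 := by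
    calc 8 = 2 ^ 3 := by norm_num
      _ ≤ (m + 1) ^ 3 := Nat.pow_le_pow_left (by omega) 3
  have e2 : (m + 1) ^ 4 = m * (m + 1) ^ 3 + (m + 1) ^ 3 := by ring
  have e1 : 2 * m * (m + 1) ^ 3 = 2 * (m * (m + 1) ^ 3) := by ring
  rw [e2, e1]
  omega

omit [Fintype σ] [DecidableEq σ] in
theorem Nm_add_two_lt (m : ℕ) (hm : 1 ≤ m) : Nm m + 2 < 2 ^ (4 * Nat.log 2 (m + 1) + 5) := by
  have hp1 : m + 1 < 2 ^ (Nat.log 2 (m + 1) + 1) := Nat.lt_pow_succ_log_self (by norm_num) (m + 1)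
  have h4 : (m + 1) ^ 4 < (2 ^ (Nat.log 2 (m + 1) + 1)) ^ 4 := Nat.pow_lt_pow_left hp1 (by norm_num)
  have e3 : 2 * (2 ^ (Nat.log 2 (m + 1) + 1)) ^ 4 = 2 ^ (4 * Nat.log 2 (m + 1) + 5) := by
    rw [← pow_mul, ← pow_succ']
    congr 1
    ring
  have h1 := Nm_add_two_le m hm
  omega

omit [Fintype σ] [DecidableEq σ] in
theorem logNm_le (m : ℕ) (hm : 1 ≤ m) : Nat.log 2 (Nm m + 2) + 1 ≤ 4 * Nat.log 2 (m + 1) + 5 := by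
  have := Nat.log_lt_of_lt_pow (by omega : Nm m + 2 ≠ 0) (Nm_add_two_lt m hm)
  omega

omit [Fintype σ] [DecidableEq σ] in
theorem sqlog_le (m : ℕ) (hm : 1 ≤ m) :
    (4 * Nat.log 2 (m + 1) + 5) * (4 * Nat.log 2 (m + 1) + 5) ≤ 194 * m := by
  have hp2 : 2 ^ Nat.log 2 (m + 1) ≤ m + 1 := Nat.pow_log_le_self 2 (by omega)
  have hpp : Nat.log 2 (m + 1) < 2 ^ Nat.log 2 (m + 1) := Nat.lt_two_pow_self
  have hp3 : Nat.log 2 (m + 1) * Nat.log 2 (m + 1) ≤ 2 ^ (Nat.log 2 (m + 1) + 1) := sq_le_two_pow_succ _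
  have h2p : 2 ^ (Nat.log 2 (m + 1) + 1) = 2 * 2 ^ Nat.log 2 (m + 1) := pow_succ' 2 _
  have e4 : (4 * Nat.log 2 (m + 1) + 5) * (4 * Nat.log 2 (m + 1) + 5) =
      16 * (Nat.log 2 (m + 1) * Nat.log 2 (m + 1)) + 40 * Nat.log 2 (m + 1) + 25 := by ring
  rw [e4]
  omega

omit [Fintype σ] [DecidableEq σ] in
theorem powNm_le (m : ℕ) (hm : 1 ≤ m) : (Nm m + 2) ^ (3 * (Nat.log 2 (Nm m + 2) + 1)) ≤ 2 ^ (582 * m) := by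
  have hN2 := Nm_add_two_lt m hm
  have hL := logNm_le m hm
  have hq := sqlog_le m hm
  calc (Nm m + 2) ^ (3 * (Nat.log 2 (Nm m + 2) + 1))
      ≤ (2 ^ (4 * Nat.log 2 (m + 1) + 5)) ^ (3 * (Nat.log 2 (Nm m + 2) + 1)) := Nat.pow_le_pow_left hN2.le _
    _ ≤ (2 ^ (4 * Nat.log 2 (m + 1) + 5)) ^ (3 * (4 * Nat.log 2 (m + 1) + 5)) :=
        Nat.pow_le_pow_right (by positivity) (Nat.mul_le_mul_left _ hL)
    _ = 2 ^ (3 * ((4 * Nat.log 2 (m + 1) + 5) * (4 * Nat.log 2 (m + 1) + 5))) := by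
        rw [← pow_mul]
        congr 1
        ring
    _ ≤ 2 ^ (582 * m) := Nat.pow_le_pow_right (by norm_num) (by omega)

omit [Fintype σ] [DecidableEq σ] in
/-- **Arithmetic**: `(m+1) · sliceBd ≤ 2^{c m} (s+2)^c` and `2^{13m}(s+2)^2 ≤ 2^{c m}(s+2)^c` with `c = 649`
(no `ring` on numeral powers of `s + 2`). [folklore] -/
theorem arith_R6b : ∃ c : ℕ,
    (∀ m s : ℕ, 1 ≤ m → (m + 1) * sliceBd m s ≤ 2 ^ (c * m) * (s + 2) ^ c) ∧
    (∀ m s : ℕ, 2 ^ (13 * m) * (s + 2) ^ 2 ≤ 2 ^ (c * m) * (s + 2) ^ c) := by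
  refine ⟨649, fun m s hm => ?_, fun m s => ?_⟩
  · have hm1 : m + 1 ≤ 2 ^ m := Nat.lt_two_pow_self
    have hsA : (s + 2) ^ 3 ≤ (s + 2) ^ 649 := Nat.pow_le_pow_right (by omega) (by norm_num)
    have hpow := powNm_le m hm
    have h2m : 2 ^ m * 2 ^ (582 * m) ≤ 2 ^ (649 * m) := by
      rw [← pow_add]
      exact Nat.pow_le_pow_right (by norm_num) (by omega)
    unfold sliceBd
    calc (m + 1) * ((s + 2) ^ 3 * (Nm m + 2) ^ (3 * (Nat.log 2 (Nm m + 2) + 1)))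
        ≤ 2 ^ m * ((s + 2) ^ 649 * 2 ^ (582 * m)) := Nat.mul_le_mul hm1 (Nat.mul_le_mul hsA hpow)
      _ = 2 ^ m * 2 ^ (582 * m) * (s + 2) ^ 649 := by
          rw [Nat.mul_comm ((s + 2) ^ 649) (2 ^ (582 * m)), ← Nat.mul_assoc]
      _ ≤ 2 ^ (649 * m) * (s + 2) ^ 649 := Nat.mul_le_mul_right _ h2m
  · exact Nat.mul_le_mul (Nat.pow_le_pow_right (by norm_num) (by omega))
      (Nat.pow_le_pow_right (by omega) (by norm_num))

/-- **R6b — the three-term rank-one law.** If ALL additive coincidences of the letter family come from ONE three-term relation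
`α = β + γ` among distinct letters (rank-one coincidence lattice), then GLOBALLY `#visible ≤ 2^{c m} (#T + 2)^c`. [folklore] -/
def RankOneThreeLaw : Prop :=
  ∃ c : ℕ, ∀ (m : ℕ) (u v : Fin m → MvPolynomial (Fin 2) ℂ), (∀ j, coeff 0 (u j) = 0) → (∀ j, coeff 0 (v j) = 0) →
    (∃ α β γ : Expo, α ≠ β ∧ α ≠ γ ∧ β ≠ γ ∧ α = β + γ ∧
      RankOneCoincidences (fun j => (u j).support ∪ (v j).support)
        (Finsupp.single β 1 + Finsupp.single γ 1) (Finsupp.single α 1)) →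
    ∀ S : Finset Expo, (∀ l ∈ S, ∃ ξ : Fin 2 → ℝ, ValidWeight u v ξ ∧ IsStrictTop ξ ↑(tailDiff u v).support l) →
      S.card ≤ 2 ^ (c * m) * ((tailSupport u v).card + 2) ^ c

omit [Fintype σ] [DecidableEq σ] in
/-- **R6b PROVED UNCONDITIONALLY** (free lift + toric Lemma A + `b`-slicing + coefficient theorem with varying letter count +
finite shift rank + val-lit-p3's `ShiftRank.pencilCount`). [folklore] -/
theorem rankOneThreeLaw : RankOneThreeLaw := by
  classical
  obtain ⟨c, hc1, hc2⟩ := arith_R6b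
  refine ⟨c, fun m u v hu hv hrel S hS => ?_⟩
  obtain ⟨α, β, γ, hab, hac, hbc, hrel, hR⟩ := hrel
  rcases S.eq_empty_or_nonempty with hSe | hSne
  · simp [hSe]
  obtain ⟨l₀, hl₀⟩ := hSne
  obtain ⟨ξ₀, hval₀, htop₀⟩ := hS l₀ hl₀
  have hm : 1 ≤ m := by
    rcases Nat.eq_zero_or_pos m with h | h
    · exfalso
      subst h
      apply mem_support_iff.mp htop₀.1
      unfold tailDiff
      simp
    · exact h
  by_cases hall : α ∈ tailSupport u v ∧ β ∈ tailSupport u v ∧ γ ∈ tailSupport u v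
  · obtain ⟨hα, hβ, hγ⟩ := hall
    let D : RelData u v := ⟨α, β, γ, hα, hβ, hγ, hab, hac, hbc, hrel⟩
    have h := (D.count hu hv hR S hS).trans (hc1 m (sE u v) hm)
    exact h
  · have hex : ∃ e : Expo, (e = α ∨ e = β ∨ e = γ) ∧ e ∉ tailSupport u v := by
      simp only [not_and_or] at hall
      rcases hall with h | h | h
      exacts [⟨α, Or.inl rfl, h⟩, ⟨β, Or.inr (Or.inl rfl), h⟩, ⟨γ, Or.inr (Or.inr rfl), h⟩]
    obtain ⟨e, he, hnot⟩ := hex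
    have hnotj : ∀ j, e ∉ (u j).support ∪ (v j).support := by
      intro j hj
      apply hnot
      rcases Finset.mem_union.mp hj with h | h
      · exact support_u_subset u v j h
      · exact support_v_subset u v j h
    have hperm : PermType (fun j => (u j).support ∪ (v j).support) :=
      permType_of_absent_letter _ α β γ hab hac hbc hR e he hnotj
    calc S.card ≤ 2 ^ (13 * m) * ((tailSupport u v).card + 2) ^ 2 := permTypeLaw_proof m u v hu hv hperm S hS
      _ ≤ 2 ^ (c * m) * ((tailSupport u v).card + 2) ^ c := hc2 m _

end FreeCount

end R6b
end Summit.ValiantsHypothesis.ValiantsHypothesis.Theorems.NewtonUnitEquations.TwoProducts.PermutationType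

end
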